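import Literature.Combinatorics.Optimization.CompletelyPsdRank
import Literature.Combinatorics.Optimization.TsirelsonExtremalCorrelations
import Literature.LinearAlgebra.CliffordRepresentationDimension
import HarnessLib

/-!
# PSVW Theorem 11 (dimension of quantum representations of extremal correlations) from Tsirelson's theorems

Source: A. Prakash, J. Sikora, A. Varvitsiotis, Z. Wei, *Completely positive semidefinite rank*,
Math. Program. 171 (2018) = arXiv:1604.07199 [PrakashEtAl2017], §8 "Proof of Theorem 11", Proof 21
(held text `paper:arxiv-1604.07199`, p24).

`PrakashEtAl2017_thm11` (`CompletelyPsdRank.lean`) is the NAMED FACT "`C ∈ ext(Cor(n,m))`,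
`c_{xy} = Tr((M_x ⊗ N_y)ρ)` with `M_x, N_y ∈ H^d`, eigenvalues in `[−1,1]`, `ρ` a state ⇒
`d ≥ √2^{⌊rank(C)/2⌋}`". PSVW prove it from two results of Tsirelson [Tsirelson1987] which they
restate without proof (Lemma 12, Theorem 20; typed as `Tsirelson1987_lemma12`, `Tsirelson1987_thm20`
in `TsirelsonExtremalCorrelations.lean`) and the dimension of Clifford modules (their Theorem 19;
PROVED in `Literature/LinearAlgebra/CliffordRepresentationDimension.lean`). This file formalizes
PSVW's Proof 21 itself, so that Theorem 11 is DERIVABLE from the two Tsirelson facts: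
`PrakashEtAl2017_thm11_of_tsirelson : Tsirelson1987_lemma12 → Tsirelson1987_thm20 →
PrakashEtAl2017_thm11`. Both Tsirelson facts are meanwhile THEOREMS
(`Tsirelson1987_lemma12_holds`, `Tsirelson1987_thm20_holds` in `TsirelsonExtremalCorrelations.lean`),
so this file also records the unconditional forms `PrakashEtAl2017_thm11_holds`,
`PrakashEtAl2017_thm16_holds` (PSVW's main Theorem 16) and `PrakashEtAl2017_result1`.

Steps (all proved): `A_x = M_x ⊗ I`, `B_y = I ⊗ N_y` satisfy (i)–(iv) on `ℂ^{d²}`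
(`isRep_kronecker`); an orthogonal projector `P ≠ I` factors as `V Vᴴ` through an isometry
(`exists_isometry_of_projector`, spectral theorem) and compressing along it preserves (i)–(iv)
(`isRep_compress`) — so a representation of minimal dimension `D' ≤ d²` satisfies (v); Lemma 12
moves a `C`-system into `ℝ^{τ_C}` (an orthonormal basis of `span{u_x}`), Theorem 20 gives
`{A_x, A_{x'}} = 2⟨u_x, u_{x'}⟩ I`, a basis is selected among the `u_x`
(`exists_linearIndependent_subfamily`, nonsingular Gram matrix `det_gram_ne_zero`), and
`two_pow_dvd_of_anticommutator_eq_gram` yields `2^{⌊τ/2⌋} ∣ D'`; finally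
`rank C ≤ τ` (`rank_le_of_isCSystem`) and `D' ≤ d²`.

Appended (2026-08-27, Gribling–de Laat–Laurent [GriblingDelaatLaurent2017] §§4–5, toward their
Theorem 1.1 in `CpsdRankHadamardMatrices.lean`): `GriblingDelaatLaurent2017_thm44` (GdLL Theorem 4.4:
a commuting operator representation of an extreme `C` has size `≥ (2^{⌊rank C/2⌋})²` — the same
Proof 21 run on both Clifford families with the two-sided dimension bound
`Literature.LinearAlgebra.two_pow_mul_two_pow_dvd_of_anticommutator_eq_gram_of_commute`),
`GriblingDelaatLaurent2017_cor45` (Corollary 4.5: tensor operator representations need local dimension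
`≥ 2^{⌊rank C/2⌋}`, squaring PSVW Theorem 11), `exists_tensorRep_of_cpsdFactorization_quarterTable`
(Theorem 5.1 "⇐" with Lemma 5.2: a `CS_+`-factorization of the table `¼(1 ± G_{zz'})` of size `d` gives
a tensor operator representation of the off-diagonal block of `G` in local dimension `≤ d`, PSVW's
compression run two-sidedly) and `GriblingDelaatLaurent2017_quarterTable_lower` (hence such
factorizations have size `≥ 2^{⌊rank C/2⌋}` when that block is an extreme `C`). Second append:
`two_pow_le_of_hasCpsdFactorization_behaviorMatrix` and `PrakashEtAl2017_result1_sharp` — PSVW Theorem 16 /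
Result 1 with the exponent squared (`2^{⌊r/2⌋}` for `√2^{⌊r/2⌋}`), Corollary 4.5 replacing Theorem 11. Third append:
`exists_tensorRep_of_isCSystem` (GdLL Theorem 4.1 (1)⇒(2) / Corollary 4.2: tensor operator
representations in local dimension `≤ 2^{⌊N/2⌋}` from a `C`-system in `ℝ^N`),
`GriblingDelaatLaurent2017_cor45_exists` and `GriblingDelaatLaurent2017_cor45_isLeast` (Corollary 4.5 as
printed: the minimum local dimension IS `2^{⌊rank C/2⌋}`). Fourth append: PSVW Theorem 10 (i)⇔(iii)
[Tsirelson] assembled: `mem_quantumCorrelations_of_tensorRep`, `PrakashEtAl2017_thm10_i_iff_iii`,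
`exists_tensorRep_of_mem_quantumCorrelations`.
-/

noncomputable section

open Matrix Finset
open scoped MatrixOrder ComplexOrder Kronecker

namespace Literature.Combinatorics.Optimization


section Reduction

variable {n m : ℕ}

/-- `(A ⊗ B)ᴴ = Aᴴ ⊗ Bᴴ`: Kronecker products of Hermitian matrices are Hermitian. [folklore] -/
private theorem isHermitian_kronecker {p q : Type*} {M : Matrix p p ℂ} {N : Matrix q q ℂ}
    (hM : M.IsHermitian) (hN : N.IsHermitian) : (M ⊗ₖ N).IsHermitian := by
  unfold Matrix.IsHermitian
  rw [conjTranspose_kronecker, hM.eq, hN.eq]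

/-- `I − M ⊗ I = (I − M) ⊗ I`. [folklore] -/
private theorem one_sub_kronecker_one {p q : Type*} [DecidableEq p] [DecidableEq q]
    (M : Matrix p p ℂ) :
    (1 : Matrix (p × q) (p × q) ℂ) - M ⊗ₖ (1 : Matrix q q ℂ) = (1 - M) ⊗ₖ 1 := by
  ext ⟨i, j⟩ ⟨i', j'⟩
  simp only [Matrix.sub_apply, Matrix.kroneckerMap_apply, Matrix.one_apply, Prod.mk.injEq]
  by_cases hi : i = i' <;> by_cases hj : j = j' <;> simp [hi, hj]

/-- `I − I ⊗ N = I ⊗ (I − N)`. [folklore] -/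
private theorem one_sub_one_kronecker {p q : Type*} [DecidableEq p] [DecidableEq q]
    (N : Matrix q q ℂ) :
    (1 : Matrix (p × q) (p × q) ℂ) - (1 : Matrix p p ℂ) ⊗ₖ N = 1 ⊗ₖ (1 - N) := by
  ext ⟨i, j⟩ ⟨i', j'⟩
  simp only [Matrix.sub_apply, Matrix.kroneckerMap_apply, Matrix.one_apply, Prod.mk.injEq]
  by_cases hi : i = i' <;> by_cases hj : j = j' <;> simp [hi, hj]

/-- Step 1 (PSVW Proof 21, first paragraph): `A_x = M_x ⊗ I`, `B_y = I ⊗ N_y` satisfy (i)–(iv).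
[cite: PrakashEtAl2017, proof of Thm. 11 (p24)] -/
private theorem isRep_kronecker {d : ℕ} (C : Matrix (Fin n) (Fin m) ℝ)
    (M : Fin n → Matrix (Fin d) (Fin d) ℂ) (N : Fin m → Matrix (Fin d) (Fin d) ℂ)
    (ρ : Matrix (Fin d × Fin d) (Fin d × Fin d) ℂ)
    (hM : ∀ x, (M x).IsHermitian ∧ (1 - M x).PosSemidef ∧ (1 + M x).PosSemidef)
    (hN : ∀ y, (N y).IsHermitian ∧ (1 - N y).PosSemidef ∧ (1 + N y).PosSemidef)
    (hρ : ρ.PosSemidef) (hρ1 : ρ.trace = 1)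
    (hC : ∀ x y, ((C x y : ℝ) : ℂ) = ((M x ⊗ₖ N y) * ρ).trace) :
    ((∀ x y, ((C x y : ℝ) : ℂ) = ((M x ⊗ₖ (1 : Matrix (Fin d) (Fin d) ℂ)) * ((1 : Matrix (Fin d) (Fin d) ℂ) ⊗ₖ N y) * ρ).trace) ∧
      (∀ x y, (M x ⊗ₖ (1 : Matrix (Fin d) (Fin d) ℂ)) * ((1 : Matrix (Fin d) (Fin d) ℂ) ⊗ₖ N y) = ((1 : Matrix (Fin d) (Fin d) ℂ) ⊗ₖ N y) * (M x ⊗ₖ (1 : Matrix (Fin d) (Fin d) ℂ))) ∧ ρ.PosSemidef ∧ ρ.trace = 1 ∧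
      (∀ x, ((M x ⊗ₖ (1 : Matrix (Fin d) (Fin d) ℂ))).IsHermitian ∧ (1 - (M x ⊗ₖ (1 : Matrix (Fin d) (Fin d) ℂ))).PosSemidef ∧ (1 + (M x ⊗ₖ (1 : Matrix (Fin d) (Fin d) ℂ))).PosSemidef) ∧
      (∀ y, (((1 : Matrix (Fin d) (Fin d) ℂ) ⊗ₖ N y)).IsHermitian ∧ (1 - ((1 : Matrix (Fin d) (Fin d) ℂ) ⊗ₖ N y)).PosSemidef ∧ (1 + ((1 : Matrix (Fin d) (Fin d) ℂ) ⊗ₖ N y)).PosSemidef)) := by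
  have h1 : (1 : Matrix (Fin d) (Fin d) ℂ).PosSemidef := PosSemidef.one
  refine ⟨fun x y => ?_, fun x y => ?_, hρ, hρ1, fun x => ⟨?_, ?_, ?_⟩, fun y => ⟨?_, ?_, ?_⟩⟩
  · rw [hC, ← mul_kronecker_mul, Matrix.mul_one, Matrix.one_mul]
  · rw [← mul_kronecker_mul, ← mul_kronecker_mul, Matrix.mul_one, Matrix.one_mul, Matrix.mul_one,
      Matrix.one_mul]
  · exact isHermitian_kronecker (hM x).1 isHermitian_one
  · rw [one_sub_kronecker_one]; exact (hM x).2.1.kronecker h1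
  · rw [← one_kronecker_one, ← add_kronecker]; exact (hM x).2.2.kronecker h1
  · exact isHermitian_kronecker isHermitian_one (hN y).1
  · rw [one_sub_one_kronecker]; exact h1.kronecker (hN y).2.1
  · rw [← one_kronecker_one, ← kronecker_add]; exact h1.kronecker (hN y).2.2

/-- An orthogonal projector `P ≠ I` (Hermitian idempotent) factors as `P = V Vᴴ` through an isometry
`V : ℂ^r → ℂ^σ`, `Vᴴ V = I_r`, with `r < |σ|` (columns of `V` = the eigenvectors of `P` with
eigenvalue `1`). [folklore] -/
private theorem exists_isometry_of_projector {σ : Type} [Fintype σ] [DecidableEq σ]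
    {P : Matrix σ σ ℂ} (hPh : P.IsHermitian) (hPP : P * P = P) (hP1 : P ≠ 1) :
    ∃ r : ℕ, r < Fintype.card σ ∧ ∃ V : Matrix σ (Fin r) ℂ, Vᴴ * V = 1 ∧ V * Vᴴ = P := by
  classical
  set U : Matrix σ σ ℂ := (hPh.eigenvectorUnitary : Matrix σ σ ℂ) with hU
  have hUU : Uᴴ * U = 1 := by
    rw [← star_eq_conjTranspose]; exact Unitary.coe_star_mul_self hPh.eigenvectorUnitary
  have hUU' : U * Uᴴ = 1 := by
    rw [← star_eq_conjTranspose]; exact Unitary.coe_mul_star_self hPh.eigenvectorUnitary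
  obtain ⟨lam, hlam⟩ : ∃ lam : σ → ℝ, lam = hPh.eigenvalues := ⟨_, rfl⟩
  obtain ⟨D, hD⟩ : ∃ D : Matrix σ σ ℂ, D = diagonal fun j => ((lam j : ℝ) : ℂ) := ⟨_, rfl⟩
  -- `P U = U D`
  have hPU : P * U = U * D := by
    ext k j
    have h := congrFun (hPh.mulVec_eigenvectorBasis j) k
    simp only [Matrix.mulVec, dotProduct, Pi.smul_apply, Complex.real_smul] at h
    rw [hD, mul_diagonal, Matrix.mul_apply]
    simp only [hU, Matrix.IsHermitian.eigenvectorUnitary_apply]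
    rw [h, mul_comm, hlam]
  have hPUD : P = U * D * Uᴴ := by
    rw [← hPU, Matrix.mul_assoc, hUU', Matrix.mul_one]
  -- eigenvalues are `0` or `1`
  have hDD : D * D = D := by
    have h1 : U * (D * D) = U * D := by
      rw [← Matrix.mul_assoc, ← hPU, Matrix.mul_assoc, ← hPU, ← Matrix.mul_assoc, hPP]
    have h2 := congrArg (fun X => Uᴴ * X) h1
    simpa only [← Matrix.mul_assoc, hUU, Matrix.one_mul] using h2
  have hlam01 : ∀ j, lam j = 0 ∨ lam j = 1 := fun j => by
    have h := congrFun (congrFun hDD j) j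
    rw [hD, diagonal_mul_diagonal, diagonal_apply_eq, diagonal_apply_eq] at h
    have h' : (lam j : ℝ) * lam j = lam j := by exact_mod_cast h
    rcases mul_eq_zero.mp (show lam j * (lam j - 1) = 0 by linear_combination h') with h0 | h1
    · exact Or.inl h0
    · exact Or.inr (by linarith)
  -- the index set of the eigenvalue `1`
  let S := {j : σ // lam j = 1}
  let r := Fintype.card S
  let e : S ≃ Fin r := Fintype.equivFin S
  have hr : r < Fintype.card σ := by
    by_contra hge'
    have hge : Fintype.card σ ≤ r := not_lt.mp hge'
    -- then every eigenvalue is `1`, `D = 1`, `P = 1`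
    have hall : ∀ j, lam j = 1 := by
      have hcard : Fintype.card S = Fintype.card σ :=
        le_antisymm (Fintype.card_subtype_le _) hge
      have hsurj : Function.Surjective (fun j : S => (j : σ)) :=
        (Function.Injective.bijective_of_nat_card_le Subtype.val_injective
          (by simp only [Nat.card_eq_fintype_card]; exact hge)).2
      intro j
      obtain ⟨⟨j', hj'⟩, rfl⟩ := hsurj j
      exact hj'
    apply hP1
    rw [hPUD]
    have hD1 : D = 1 := by
      rw [hD]; ext i j
      rw [diagonal_apply, Matrix.one_apply]
      split_ifs with h
      · rw [hall i]; simp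
      · rfl
    rw [hD1, Matrix.mul_one, hUU']
  refine ⟨r, hr, fun k a => U k (e.symm a).1, ?_, ?_⟩
  · -- `Vᴴ V = 1`
    ext a a'
    have h := congrFun (congrFun hUU (e.symm a).1) (e.symm a').1
    rw [Matrix.mul_apply] at h ⊢
    simp only [conjTranspose_apply] at h ⊢
    rw [h, Matrix.one_apply, Matrix.one_apply]
    by_cases haa : a = a'
    · subst haa; simp
    · have : (e.symm a).1 ≠ (e.symm a').1 := fun h' =>
        haa (e.symm.injective (Subtype.ext h'))
      simp [haa, this]
  · -- `V Vᴴ = U D Uᴴ = P`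
    rw [hPUD]
    ext k k'
    rw [Matrix.mul_apply, Matrix.mul_apply]
    simp only [conjTranspose_apply, mul_diagonal, hD]
    -- RHS: Σ_j U k j * d j * conj (U k' j); LHS: Σ_a U k (j a) * conj (U k' (j a))
    have hR : ∑ j, U k j * ((lam j : ℝ) : ℂ) * star (U k' j) =
        ∑ j ∈ univ.filter (fun j => lam j = 1), U k j * star (U k' j) := by
      rw [Finset.sum_filter]
      refine Finset.sum_congr rfl fun j _ => ?_
      rcases hlam01 j with h | h <;> simp [h]
    rw [hR, Finset.sum_subtype (univ.filter fun j => lam j = 1) (p := fun j => lam j = 1) (by simp)]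
    exact (e.symm.sum_comp (fun j : S => U k j.1 * star (U k' j.1)))

/-- Step 2 (PSVW Proof 21: "if there exists an orthogonal projector `P ≠ I` …, by restricting on the
support … we get a new family of operators that satisfy conditions (i)–(iv) … that have smaller
size"): compression `A ↦ Vᴴ A V` along the isometry of `exists_isometry_of_projector`.
[cite: PrakashEtAl2017, proof of Thm. 11 (p24)] -/
private theorem isRep_compress {σ : Type} [Fintype σ] [DecidableEq σ] {C : Matrix (Fin n) (Fin m) ℝ}
    {A : Fin n → Matrix σ σ ℂ} {B : Fin m → Matrix σ σ ℂ} {ρ : Matrix σ σ ℂ}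
    (h : ((∀ x y, ((C x y : ℝ) : ℂ) = (A x * B y * ρ).trace) ∧
      (∀ x y, A x * B y = B y * A x) ∧ ρ.PosSemidef ∧ ρ.trace = 1 ∧
      (∀ x, (A x).IsHermitian ∧ (1 - A x).PosSemidef ∧ (1 + A x).PosSemidef) ∧
      (∀ y, (B y).IsHermitian ∧ (1 - B y).PosSemidef ∧ (1 + B y).PosSemidef))) {P : Matrix σ σ ℂ} (hPh : P.IsHermitian) (hPP : P * P = P)
    (hP1 : P ≠ 1) (hPA : ∀ x, P * A x = A x * P) (hPB : ∀ y, P * B y = B y * P)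
    (hPρ : P * ρ * P = ρ) :
    ∃ r : ℕ, r < Fintype.card σ ∧ ∃ (A' : Fin n → Matrix (Fin r) (Fin r) ℂ)
      (B' : Fin m → Matrix (Fin r) (Fin r) ℂ) (ρ' : Matrix (Fin r) (Fin r) ℂ),
      ((∀ x y, ((C x y : ℝ) : ℂ) = (A' x * B' y * ρ').trace) ∧
      (∀ x y, A' x * B' y = B' y * A' x) ∧ ρ'.PosSemidef ∧ ρ'.trace = 1 ∧
      (∀ x, (A' x).IsHermitian ∧ (1 - A' x).PosSemidef ∧ (1 + A' x).PosSemidef) ∧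
      (∀ y, (B' y).IsHermitian ∧ (1 - B' y).PosSemidef ∧ (1 + B' y).PosSemidef)) := by
  obtain ⟨hc, hcomm, hρ, hρ1, hA, hB⟩ := h
  obtain ⟨r, hr, V, hVV, hVP⟩ := exists_isometry_of_projector hPh hPP hP1
  have hPρ' : P * ρ = ρ := by
    rw [← hPρ, ← Matrix.mul_assoc, ← Matrix.mul_assoc, hPP]
  have hρP : ρ * P = ρ := by
    rw [← hPρ, Matrix.mul_assoc, hPP]
  refine ⟨r, hr, fun x => Vᴴ * A x * V, fun y => Vᴴ * B y * V, Vᴴ * ρ * V, fun x y => ?_,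
    fun x y => ?_, hρ.conjTranspose_mul_mul_same V, ?_, fun x => ⟨?_, ?_, ?_⟩, fun y => ⟨?_, ?_, ?_⟩⟩
  · -- (i)
    have key1 : A x * ((V * Vᴴ) * (B y * ((V * Vᴴ) * ρ))) = A x * (B y * ρ) := by
      rw [hVP, hPρ', ← Matrix.mul_assoc P, hPB, Matrix.mul_assoc, hPρ']
    have e1 : Vᴴ * A x * V * (Vᴴ * B y * V) * (Vᴴ * ρ * V) = Vᴴ * (A x * (B y * ρ)) * V := by
      calc Vᴴ * A x * V * (Vᴴ * B y * V) * (Vᴴ * ρ * V)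
          = Vᴴ * (A x * ((V * Vᴴ) * (B y * ((V * Vᴴ) * ρ)))) * V := by
            simp only [Matrix.mul_assoc]
        _ = Vᴴ * (A x * (B y * ρ)) * V := by rw [key1]
    have e2 : P * (A x * (B y * ρ)) = A x * B y * ρ := by
      calc P * (A x * (B y * ρ)) = (P * A x) * (B y * ρ) := by simp only [Matrix.mul_assoc]
        _ = A x * ((P * B y) * ρ) := by rw [hPA]; simp only [Matrix.mul_assoc]
        _ = A x * (B y * (P * ρ)) := by rw [hPB]; simp only [Matrix.mul_assoc]
        _ = A x * B y * ρ := by rw [hPρ']; simp only [Matrix.mul_assoc]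
    rw [hc x y, e1, Matrix.trace_mul_cycle Vᴴ (A x * (B y * ρ)) V, hVP, e2]
  · -- (ii)
    have key : A x * P * B y = B y * P * A x := by
      rw [Matrix.mul_assoc, hPB, ← Matrix.mul_assoc, hcomm, Matrix.mul_assoc, ← hPA,
        ← Matrix.mul_assoc]
    calc Vᴴ * A x * V * (Vᴴ * B y * V) = Vᴴ * (A x * P * B y) * V := by
          rw [← hVP]; simp only [Matrix.mul_assoc]
      _ = Vᴴ * (B y * P * A x) * V := by rw [key]
      _ = Vᴴ * B y * V * (Vᴴ * A x * V) := by rw [← hVP]; simp only [Matrix.mul_assoc]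
  · -- trace
    rw [Matrix.trace_mul_cycle Vᴴ ρ V, hVP, hPρ', hρ1]
  · exact isHermitian_conjTranspose_mul_mul V (hA x).1
  · have : (1 : Matrix (Fin r) (Fin r) ℂ) - Vᴴ * A x * V = Vᴴ * (1 - A x) * V := by
      rw [Matrix.mul_sub, Matrix.sub_mul, Matrix.mul_one, hVV]
    rw [this]; exact (hA x).2.1.conjTranspose_mul_mul_same V
  · have : (1 : Matrix (Fin r) (Fin r) ℂ) + Vᴴ * A x * V = Vᴴ * (1 + A x) * V := by
      rw [Matrix.mul_add, Matrix.add_mul, Matrix.mul_one, hVV]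
    rw [this]; exact (hA x).2.2.conjTranspose_mul_mul_same V
  · exact isHermitian_conjTranspose_mul_mul V (hB y).1
  · have : (1 : Matrix (Fin r) (Fin r) ℂ) - Vᴴ * B y * V = Vᴴ * (1 - B y) * V := by
      rw [Matrix.mul_sub, Matrix.sub_mul, Matrix.mul_one, hVV]
    rw [this]; exact (hB y).2.1.conjTranspose_mul_mul_same V
  · have : (1 : Matrix (Fin r) (Fin r) ℂ) + Vᴴ * B y * V = Vᴴ * (1 + B y) * V := by
      rw [Matrix.mul_add, Matrix.add_mul, Matrix.mul_one, hVV]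
    rw [this]; exact (hB y).2.2.conjTranspose_mul_mul_same V

/-- The correlation matrix of a `C`-system in `ℝ^N` has rank `≤ N` (PSVW p24: "note that
`rank(C) ≤ τ_C`"). [cite: PrakashEtAl2017, proof of Lemma 12 remark (p24)] -/
private theorem rank_le_of_isCSystem {N : ℕ} {C : Matrix (Fin n) (Fin m) ℝ}
    {u : Fin n → EuclideanSpace ℝ (Fin N)} {v : Fin m → EuclideanSpace ℝ (Fin N)}
    (h : IsCSystem C u v) : C.rank ≤ N := by
  let U : Matrix (Fin N) (Fin n) ℝ := Matrix.of fun i x => (u x : EuclideanSpace ℝ (Fin N)) i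
  let W : Matrix (Fin N) (Fin m) ℝ := Matrix.of fun i y => (v y : EuclideanSpace ℝ (Fin N)) i
  have hC : C = Uᵀ * W := by
    ext x y
    rw [h.2.2 x y, EuclideanSpace.inner_eq_star_dotProduct, star_trivial, Matrix.mul_apply,
      dotProduct]
    exact Finset.sum_congr rfl fun i _ => mul_comm _ _
  rw [hC]
  exact (Matrix.rank_mul_le_left _ _).trans (Matrix.rank_le_card_width _ |>.trans (by simp))

/-- From a family spanning `ℝ^τ` one can select `τ` linearly independent members ("without loss of
generality assume that `{u_x}_{x=1}^τ` is a basis", PSVW p24). [folklore] -/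
private theorem exists_linearIndependent_subfamily {τ : ℕ} (u : Fin n → EuclideanSpace ℝ (Fin τ))
    (hu : Submodule.span ℝ (Set.range u) = ⊤) :
    ∃ e : Fin τ → Fin n, LinearIndependent ℝ (u ∘ e) := by
  classical
  obtain ⟨b, hbsub, hbspan, hbli⟩ := exists_linearIndependent ℝ (Set.range u)
  rw [hu] at hbspan
  haveI : Fintype b := Set.Finite.fintype ((Set.finite_range u).subset hbsub)
  -- `b` is a basis of `ℝ^τ`, so `|b| = τ`
  have hcard : Fintype.card b = τ := by
    have hB := Module.Basis.mk hbli (by rw [Subtype.range_coe_subtype, Set.setOf_mem_eq, hbspan])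
    rw [← Module.finrank_eq_card_basis hB, finrank_euclideanSpace_fin]
  let e' : b ≃ Fin τ := Fintype.equivFinOfCardEq hcard
  -- choose indices
  have hpre : ∀ w : b, ∃ x, u x = w := fun w => hbsub w.2
  choose g hg using hpre
  refine ⟨fun k => g (e'.symm k), ?_⟩
  have : u ∘ (fun k => g (e'.symm k)) = (fun w : b => (w : EuclideanSpace ℝ (Fin τ))) ∘ e'.symm := by
    funext k; simp [hg]
  rw [this]
  exact hbli.comp _ e'.symm.injective

/-- The Gram matrix of a linearly independent family `w_1,…,w_τ ∈ ℝ^τ` is nonsingular. [folklore] -/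
private theorem det_gram_ne_zero {τ : ℕ} {w : Fin τ → EuclideanSpace ℝ (Fin τ)}
    (hw : LinearIndependent ℝ w) :
    (Matrix.of fun k k' => inner ℝ (w k) (w k') : Matrix (Fin τ) (Fin τ) ℝ).det ≠ 0 := by
  let Wm : Matrix (Fin τ) (Fin τ) ℝ := Matrix.of fun i k => (w k : EuclideanSpace ℝ (Fin τ)) i
  have hG : (Matrix.of fun k k' => inner ℝ (w k) (w k') : Matrix (Fin τ) (Fin τ) ℝ) = Wmᵀ * Wm := by
    ext k k'
    rw [Matrix.of_apply, EuclideanSpace.inner_eq_star_dotProduct, star_trivial, Matrix.mul_apply,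
      dotProduct]
    exact Finset.sum_congr rfl fun i _ => mul_comm _ _
  -- the columns of `Wm` are the coordinate vectors of the `w k`, linearly independent
  have hcols : LinearIndependent ℝ Wm.col := by
    have e : Wm.col = (WithLp.linearEquiv 2 ℝ (Fin τ → ℝ)) ∘ w := by
      funext k; ext i; rfl
    rw [e]
    exact hw.map' _ (LinearEquiv.ker _)
  have hunit : IsUnit Wm := Matrix.linearIndependent_cols_iff_isUnit.mp hcols
  rw [hG, det_mul, det_transpose]
  have hdet : Wm.det ≠ 0 := by
    have := (Matrix.isUnit_iff_isUnit_det Wm).mp hunit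
    exact this.ne_zero
  exact mul_ne_zero hdet hdet

/-- **PSVW Theorem 11 from Tsirelson's Lemma 12 and Theorem 20** (PSVW §8, Proof 21, p24): given the
two results of [TS87] restated by PSVW (`Tsirelson1987_lemma12`, `Tsirelson1987_thm20`), the
dimension bound `d ≥ √2^{⌊rank(C)/2⌋}` for quantum representations of an extremal correlation
follows: `A_x = M_x ⊗ I`, `B_y = I ⊗ N_y` act on `ℂ^{d²}` (`isRep_kronecker`); a representation of
minimal dimension `D' ≤ d²` is irreducible in the sense (v) (else compress, `isRep_compress`);
Lemma 12 gives a `C`-system spanning `ℝ^{τ}`, Theorem 20 the relations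
`{A_x, A_{x'}} = 2⟨u_x,u_{x'}⟩ I`, and the Clifford dimension bound
(`Literature.LinearAlgebra.two_pow_dvd_of_anticommutator_eq_gram`, applied to a basis among the
`u_x`) gives `2^{⌊τ/2⌋} ∣ D'`, whence `d² ≥ D' ≥ 2^{⌊τ/2⌋} ≥ 2^{⌊rank C/2⌋}`.
[cite: PrakashEtAl2017, Thm. 11, proof (§8, p24)] -/
theorem PrakashEtAl2017_thm11_of_tsirelson (h12 : Tsirelson1987_lemma12)
    (h20 : Tsirelson1987_thm20) : PrakashEtAl2017_thm11 := by
  intro n m d C hC M N ρ hM hN hρ hρ1 hc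
  classical
  have hC' : C ∈ Set.extremePoints ℝ (quantumCorrelations n m) := hC
  -- `d ≥ 1` since `tr ρ = 1`
  have hd : 1 ≤ d := by
    by_contra h0
    have hd0 : d = 0 := by omega
    subst hd0
    have : ρ.trace = 0 := by simp [Matrix.trace]
    exact zero_ne_one (this.symm.trans hρ1)
  -- degenerate Bell scenarios (`n = 0` or `m = 0`): `rank C = 0`
  have htriv : C.rank = 0 → Real.sqrt 2 ^ (C.rank / 2) ≤ (d : ℝ) := fun h0 => by
    rw [h0, Nat.zero_div, pow_zero]
    exact_mod_cast hd
  rcases Nat.eq_zero_or_pos n with hn0 | hn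
  · subst hn0
    exact htriv (Nat.le_zero.mp ((Matrix.rank_le_card_height C).trans (by simp)))
  rcases Nat.eq_zero_or_pos m with hm0 | hm
  · subst hm0
    exact htriv (Nat.le_zero.mp ((Matrix.rank_le_card_width C).trans (by simp)))
  -- representations of `C` satisfying (i)–(iv), by dimension
  let Q : ℕ → Prop := fun r => ∃ (σ : Type) (_ : Fintype σ) (_ : DecidableEq σ),
    Fintype.card σ = r ∧ ∃ (A : Fin n → Matrix σ σ ℂ) (B : Fin m → Matrix σ σ ℂ) (ρ' : Matrix σ σ ℂ),
      ((∀ x y, ((C x y : ℝ) : ℂ) = (A x * B y * ρ').trace) ∧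
      (∀ x y, A x * B y = B y * A x) ∧ ρ'.PosSemidef ∧ ρ'.trace = 1 ∧
      (∀ x, (A x).IsHermitian ∧ (1 - A x).PosSemidef ∧ (1 + A x).PosSemidef) ∧
      (∀ y, (B y).IsHermitian ∧ (1 - B y).PosSemidef ∧ (1 + B y).PosSemidef))
  have hQd : Q (d * d) := ⟨Fin d × Fin d, inferInstance, inferInstance, by simp, _, _, ρ,
    isRep_kronecker C M N ρ hM hN hρ hρ1 hc⟩
  have hQ : ∃ r, Q r := ⟨_, hQd⟩
  obtain ⟨σ, _, _, hcard, A, B, ρ', hrep⟩ := Nat.find_spec hQ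
  have hmin : ∀ r, r < Nat.find hQ → ¬ Q r := fun r hr => Nat.find_min hQ hr
  have hle : Nat.find hQ ≤ d * d := Nat.find_min' hQ hQd
  -- the minimal representation is irreducible, condition (v)
  have hv : ¬ ∃ P : Matrix σ σ ℂ, P.IsHermitian ∧ P * P = P ∧ P ≠ 1 ∧
      (∀ x, P * A x = A x * P) ∧ (∀ y, P * B y = B y * P) ∧ P * ρ' * P = ρ' := by
    rintro ⟨P, hPh, hPP, hP1, hPA, hPB, hPρ⟩
    obtain ⟨r, hr, A', B', ρ'', hrep'⟩ := isRep_compress hrep hPh hPP hP1 hPA hPB hPρ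
    exact hmin r (hcard ▸ hr) ⟨Fin r, inferInstance, inferInstance, Fintype.card_fin r, A', B', ρ'',
      hrep'⟩
  -- it has positive dimension (`tr ρ' = 1`)
  have hpos : 0 < Nat.find hQ := by
    rw [← hcard]
    by_contra h0
    have h0' : Fintype.card σ = 0 := by omega
    haveI : IsEmpty σ := Fintype.card_eq_zero_iff.mp h0'
    have : ρ'.trace = 0 := by simp [Matrix.trace]
    exact zero_ne_one (this.symm.trans hrep.2.2.2.1)
  -- a `C`-system in `ℝ^τ` (Lemma 12)
  obtain ⟨hspan, τ, hτ1, hdimτ⟩ := h12 n m C hn hm hC'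
  obtain ⟨u0, v0, hu0, hv0, hCuv⟩ := hC'.1
  have hsys0 : IsCSystem C u0 v0 := ⟨fun x => (hu0 x).le, fun y => (hv0 y).le, hCuv⟩
  let W : Submodule ℝ (EuclideanSpace ℝ (Fin (n + m))) := Submodule.span ℝ (Set.range u0)
  have hW : Module.finrank ℝ W = τ := hdimτ _ u0 v0 hsys0
  let φ : W ≃ₗᵢ[ℝ] EuclideanSpace ℝ (Fin τ) := ((stdOrthonormalBasis ℝ W).reindex (finCongr hW)).repr
  have huW : ∀ x, u0 x ∈ W := fun x => Submodule.subset_span ⟨x, rfl⟩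
  have hvW : ∀ y, v0 y ∈ W := fun y => by
    show v0 y ∈ Submodule.span ℝ (Set.range u0)
    rw [hspan _ u0 v0 hsys0]
    exact Submodule.subset_span ⟨y, rfl⟩
  let u : Fin n → EuclideanSpace ℝ (Fin τ) := fun x => φ ⟨u0 x, huW x⟩
  let v : Fin m → EuclideanSpace ℝ (Fin τ) := fun y => φ ⟨v0 y, hvW y⟩
  have hsys : IsCSystem C u v := by
    refine ⟨fun x => ?_, fun y => ?_, fun x y => ?_⟩
    · simp only [u, LinearIsometryEquiv.norm_map]
      exact (hu0 x).le
    · simp only [v, LinearIsometryEquiv.norm_map]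
      exact (hv0 y).le
    · simp only [u, v, LinearIsometryEquiv.inner_map_map, Submodule.coe_inner]
      exact hCuv x y
  have hspan_u : Submodule.span ℝ (Set.range u) = ⊤ := by
    apply Submodule.eq_top_of_finrank_eq
    rw [finrank_euclideanSpace_fin]
    exact hdimτ _ u v hsys
  -- Theorem 20 on the minimal representation
  obtain ⟨hAA, -⟩ := h20 n m σ C hn hm hC' A B ρ' hrep.1 hrep.2.1 hrep.2.2.1 hrep.2.2.2.1 hrep.2.2.2.2.1
    hrep.2.2.2.2.2 hv τ u v hsys
  -- a basis among the `u_x` and its (nonsingular) Gram matrix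
  obtain ⟨e, he⟩ := exists_linearIndependent_subfamily u hspan_u
  let G : Matrix (Fin τ) (Fin τ) ℝ := Matrix.of fun k k' => inner ℝ (u (e k)) (u (e k'))
  have hGsym : G.IsSymm := by
    ext k k'
    simp only [G, Matrix.transpose_apply, Matrix.of_apply]
    exact real_inner_comm _ _
  have hGdet : G.det ≠ 0 := det_gram_ne_zero he
  -- transport to `Fin D'` and apply the Clifford dimension bound
  let eσ : σ ≃ Fin (Nat.find hQ) := Fintype.equivFinOfCardEq hcard
  let ψ := Matrix.reindexAlgEquiv ℂ ℂ eσ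
  have hrel : ∀ k k', ψ (A (e k)) * ψ (A (e k')) + ψ (A (e k')) * ψ (A (e k)) =
      ((2 * G k k' : ℝ) : ℂ) • (1 : Matrix (Fin (Nat.find hQ)) (Fin (Nat.find hQ)) ℂ) := by
    intro k k'
    rw [← map_mul, ← map_mul, ← map_add, hAA, map_smul, map_one]
    rfl
  have hdvd := Literature.LinearAlgebra.two_pow_dvd_of_anticommutator_eq_gram
    (fun k => ψ (A (e k))) G hGsym hGdet hrel
  -- numerics: `2^{⌊rank C/2⌋} ≤ 2^{⌊τ/2⌋} ≤ D' ≤ d²`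
  have hrank : C.rank ≤ τ := rank_le_of_isCSystem hsys
  have h2 : (2 : ℝ) ^ (τ / 2) ≤ (d : ℝ) ^ 2 := by
    have h := Nat.le_of_dvd hpos hdvd
    calc (2 : ℝ) ^ (τ / 2) = ((2 ^ (τ / 2) : ℕ) : ℝ) := by push_cast; ring
      _ ≤ (Nat.find hQ : ℝ) := by exact_mod_cast h
      _ ≤ ((d * d : ℕ) : ℝ) := by exact_mod_cast hle
      _ = (d : ℝ) ^ 2 := by push_cast; ring
  have hsqrt : Real.sqrt 2 ^ (τ / 2) = Real.sqrt ((2 : ℝ) ^ (τ / 2)) := by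
    rw [Real.sqrt_eq_rpow, Real.sqrt_eq_rpow, ← Real.rpow_natCast, ← Real.rpow_natCast,
      ← Real.rpow_mul (by norm_num), ← Real.rpow_mul (by positivity), mul_comm]
  calc Real.sqrt 2 ^ (C.rank / 2) ≤ Real.sqrt 2 ^ (τ / 2) :=
        pow_le_pow_right₀ (Real.one_le_sqrt.mpr (by norm_num)) (Nat.div_le_div_right hrank)
    _ = Real.sqrt ((2 : ℝ) ^ (τ / 2)) := hsqrt
    _ ≤ Real.sqrt ((d : ℝ) ^ 2) := Real.sqrt_le_sqrt h2
    _ = d := Real.sqrt_sq (by positivity)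

/-- PSVW Proposition 2 in the vocabulary of `TsirelsonExtremalCorrelations.lean`:
`ext(𝓔_n) ⊆ ext(Cor(n,n))` with `Cor(n,n) = quantumCorrelations n n` (a restatement of
`PrakashEtAl2017_prop2`, whose target set is the same set written inline).
[cite: PrakashEtAl2017, Prop. 2 (p18)] -/
theorem mem_extremePoints_quantumCorrelations_of_elliptope {k : ℕ} {X : Matrix (Fin k) (Fin k) ℝ}
    (hX : X ∈ Set.extremePoints ℝ (elliptope k)) :
    X ∈ Set.extremePoints ℝ (quantumCorrelations k k) :=
  PrakashEtAl2017_prop2 hX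

end Reduction

/-! ### PSVW Theorem 16 from Theorem 11 (second part of this file)

PSVW's Proof of Theorem 16 (p19–20) combines Theorem 11 with Proposition 2 (`C ∈ ext 𝓔_n ⇒
C ∈ ext Cor(n,n)`, proved as `PrakashEtAl2017_prop2`) and Theorem 2 (`cpsd-rank(P_C) ≥ 𝒟(p_C)`,
Sikora–Varvitsiotis).  The Theorem-2 step is carried out explicitly for `M_d(ℂ)`: a
`CS_+`-factorization `{X^±_x} ⊆ H^d_+` of `P_C` has `K := X⁺_x + X⁻_x` independent of `x`
(`tr(K_x K_y) = 1`), `tr(K²) = 1`, `−K ⪯ A_x := X⁺_x − X⁻_x ⪯ K`, `tr(A_x A_y) = c_{xy}`; writing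
`K = V D Vᴴ` (`D ≻ 0` diagonal of size `r = rank K ≤ d`, `Vᴴ V = I`), the observables
`M_x := D^{-1/2} Vᴴ A_x V D^{-1/2}`, `N_y := M_yᵀ` and the pure state `ψ = vec(D)` on `ℂ^r ⊗ ℂ^r`
reproduce `c_{xy} = tr((M_x ⊗ N_y) ψψ*)`, so Theorem 11 gives `d ≥ r ≥ √2^{⌊rank C/2⌋}`:
`PrakashEtAl2017_thm16_of_thm11`, hence `PrakashEtAl2017_thm16_of_tsirelson` and
`PrakashEtAl2017_result1_of_tsirelson` (Result 1 modulo Tsirelson's Lemma 12 / Theorem 20 only);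
with Lemma 12 proved (`Tsirelson1987_lemma12_holds`), `PrakashEtAl2017_thm11_of_thm20`,
`PrakashEtAl2017_thm16_of_thm20`, `PrakashEtAl2017_result1_of_thm20` leave Theorem 20 as the only
named-fact input.
-/

section Thm16

/-- Spectral isometry of a psd matrix: `K = V D Vᴴ` with `D` a POSITIVE diagonal `r × r` matrix
(`r = rank K ≤ |σ|`) and `Vᴴ V = I_r` (columns of `V` = eigenvectors of the nonzero eigenvalues).
[folklore] -/
private theorem exists_isometry_diag_of_posSemidef {σ : Type} [Fintype σ] [DecidableEq σ]
    {K : Matrix σ σ ℂ} (hK : K.PosSemidef) :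
    ∃ r : ℕ, r ≤ Fintype.card σ ∧ ∃ (V : Matrix σ (Fin r) ℂ) (κ : Fin r → ℝ), (∀ a, 0 < κ a) ∧
      Vᴴ * V = 1 ∧ K = V * diagonal (fun a => ((κ a : ℝ) : ℂ)) * Vᴴ := by
  classical
  have hKh : K.IsHermitian := hK.1
  set U : Matrix σ σ ℂ := (hKh.eigenvectorUnitary : Matrix σ σ ℂ) with hU
  have hUU : Uᴴ * U = 1 := by
    rw [← star_eq_conjTranspose]; exact Unitary.coe_star_mul_self hKh.eigenvectorUnitary
  have hUU' : U * Uᴴ = 1 := by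
    rw [← star_eq_conjTranspose]; exact Unitary.coe_mul_star_self hKh.eigenvectorUnitary
  obtain ⟨lam, hlam⟩ : ∃ lam : σ → ℝ, lam = hKh.eigenvalues := ⟨_, rfl⟩
  obtain ⟨D, hD⟩ : ∃ D : Matrix σ σ ℂ, D = diagonal fun j => ((lam j : ℝ) : ℂ) := ⟨_, rfl⟩
  have hKU : K * U = U * D := by
    ext k j
    have h := congrFun (hKh.mulVec_eigenvectorBasis j) k
    simp only [Matrix.mulVec, dotProduct, Pi.smul_apply, Complex.real_smul] at h
    rw [hD, mul_diagonal, Matrix.mul_apply]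
    simp only [hU, Matrix.IsHermitian.eigenvectorUnitary_apply]
    rw [h, mul_comm, hlam]
  have hKUD : K = U * D * Uᴴ := by
    rw [← hKU, Matrix.mul_assoc, hUU', Matrix.mul_one]
  have hlam0 : ∀ j, 0 ≤ lam j := fun j => by rw [hlam]; exact hK.eigenvalues_nonneg j
  -- the positive eigenvalues
  let S := {j : σ // lam j ≠ 0}
  let r := Fintype.card S
  let e : S ≃ Fin r := Fintype.equivFin S
  refine ⟨r, Fintype.card_subtype_le _, fun k a => U k (e.symm a).1, fun a => lam (e.symm a).1,
    fun a => lt_of_le_of_ne (hlam0 _) (Ne.symm (e.symm a).2), ?_, ?_⟩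
  · -- `Vᴴ V = 1`
    ext a a'
    have h := congrFun (congrFun hUU (e.symm a).1) (e.symm a').1
    rw [Matrix.mul_apply] at h ⊢
    simp only [conjTranspose_apply] at h ⊢
    rw [h, Matrix.one_apply, Matrix.one_apply]
    by_cases haa : a = a'
    · subst haa; simp
    · have : (e.symm a).1 ≠ (e.symm a').1 := fun h' =>
        haa (e.symm.injective (Subtype.ext h'))
      simp [haa, this]
  · -- `K = V D' Vᴴ`
    rw [hKUD]
    ext k k'
    rw [Matrix.mul_apply, Matrix.mul_apply]
    simp only [conjTranspose_apply, mul_diagonal, hD]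
    have hR : ∑ j, U k j * ((lam j : ℝ) : ℂ) * star (U k' j) =
        ∑ j ∈ univ.filter (fun j => lam j ≠ 0), U k j * ((lam j : ℝ) : ℂ) * star (U k' j) := by
      rw [Finset.sum_filter]
      refine Finset.sum_congr rfl fun j _ => ?_
      by_cases h : lam j ≠ 0
      · rw [if_pos h]
      · rw [if_neg h]; rw [not_ne_iff.mp h]; simp
    rw [hR, Finset.sum_subtype (univ.filter fun j => lam j ≠ 0) (p := fun j => lam j ≠ 0) (by simp)]
    exact (e.symm.sum_comp (fun j : S => U k j.1 * ((lam j.1 : ℝ) : ℂ) * star (U k' j.1))).symm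

/-- A Hermitian matrix with `tr(H²) = 0` vanishes. [folklore] -/
private theorem eq_zero_of_isHermitian_of_trace_mul_self {σ : Type} [Fintype σ] {H : Matrix σ σ ℂ}
    (hH : H.IsHermitian) (h0 : (H * H).trace = 0) : H = 0 := by
  have h : (Hᴴ * H).trace = 0 := by rwa [hH.eq]
  exact Matrix.trace_conjTranspose_mul_self_eq_zero_iff.mp h

/-- Support lemma: if `X, Y ⪰ 0` and `X + Y = V D Vᴴ` with `Vᴴ V = 1`, then `X` lives on the range of
`V`: `X (V Vᴴ) = X = (V Vᴴ) X` (`Q := 1 − V Vᴴ` kills `X + Y`, so `(Qw)† X (Qw) = 0`). [folklore] -/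
private theorem mul_proj_eq_of_posSemidef {σ τ : Type} [Fintype σ] [Fintype τ] [DecidableEq σ]
    [DecidableEq τ] (V : Matrix σ τ ℂ) (D : Matrix τ τ ℂ) (hVV : Vᴴ * V = 1) {X Y : Matrix σ σ ℂ}
    (hX : X.PosSemidef) (hY : Y.PosSemidef) (hXY : X + Y = V * D * Vᴴ) :
    X * (V * Vᴴ) = X ∧ V * Vᴴ * X = X := by
  obtain ⟨Q, hQ⟩ : ∃ Q : Matrix σ σ ℂ, Q = 1 - V * Vᴴ := ⟨_, rfl⟩
  have hQh : Qᴴ = Q := by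
    rw [hQ, conjTranspose_sub, conjTranspose_one, conjTranspose_mul, conjTranspose_conjTranspose]
  have hVQ : Vᴴ * Q = 0 := by
    rw [hQ, Matrix.mul_sub, Matrix.mul_one, ← Matrix.mul_assoc, hVV, Matrix.one_mul, sub_self]
  have hKQ : (X + Y) * Q = 0 := by
    rw [hXY, Matrix.mul_assoc, hVQ, Matrix.mul_zero]
  have hQKQ : Qᴴ * (X + Y) * Q = 0 := by rw [Matrix.mul_assoc, hKQ, Matrix.mul_zero]
  have hXQ : X * Q = 0 := by
    refine Matrix.toLin'.injective (LinearMap.ext fun w => ?_)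
    rw [Matrix.toLin'_apply, Matrix.toLin'_apply, Matrix.zero_mulVec, ← mulVec_mulVec]
    have h1 : 0 ≤ star (Q *ᵥ w) ⬝ᵥ (X *ᵥ (Q *ᵥ w)) := hX.dotProduct_mulVec_nonneg _
    have h2 : 0 ≤ star (Q *ᵥ w) ⬝ᵥ (Y *ᵥ (Q *ᵥ w)) := hY.dotProduct_mulVec_nonneg _
    have hs : star (Q *ᵥ w) ⬝ᵥ (X *ᵥ (Q *ᵥ w)) + star (Q *ᵥ w) ⬝ᵥ (Y *ᵥ (Q *ᵥ w)) = 0 := by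
      rw [← dotProduct_add, ← add_mulVec, star_mulVec, ← dotProduct_mulVec, mulVec_mulVec,
        mulVec_mulVec, hQKQ, zero_mulVec, dotProduct_zero]
    exact (hX.dotProduct_mulVec_zero_iff _).mp ((add_eq_zero_iff_of_nonneg h1 h2).mp hs).1
  have hQX : Q * X = 0 := by
    have := congrArg conjTranspose hXQ
    rwa [conjTranspose_mul, hQh, hX.1.eq, conjTranspose_zero] at this
  constructor
  · rw [hQ, Matrix.mul_sub, Matrix.mul_one, sub_eq_zero] at hXQ; exact hXQ.symm
  · rw [hQ, Matrix.sub_mul, Matrix.one_mul, sub_eq_zero] at hQX; exact hQX.symm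

/-- The vec-trick: for `ψ = vec(diag c)`, `tr((M ⊗ N) ψψ*) = tr(diag(c̄) M diag(c) Nᵀ)`. [folklore] -/
private theorem trace_kronecker_mul_vecMulVec_diagonal {r : ℕ} (M N : Matrix (Fin r) (Fin r) ℂ)
    (c : Fin r → ℂ) :
    ((M ⊗ₖ N) * vecMulVec (fun p : Fin r × Fin r => diagonal c p.1 p.2)
        (star fun p : Fin r × Fin r => diagonal c p.1 p.2)).trace =
      (diagonal (star c) * M * diagonal c * Nᵀ).trace := by
  rw [mul_vecMulVec, trace_vecMulVec]
  simp only [dotProduct, mulVec, Fintype.sum_prod_type, Pi.star_apply, diagonal_apply,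
    kroneckerMap_apply, trace, diag_apply, Matrix.mul_apply, transpose_apply, apply_ite star,
    star_zero, mul_ite, mul_zero, ite_mul, zero_mul, Finset.sum_ite_eq, Finset.sum_ite_eq',
    Finset.mem_univ, if_true, Finset.sum_mul]
  refine Finset.sum_congr rfl fun i _ => Finset.sum_congr rfl fun k _ => ?_
  ring

/-- **PSVW Theorem 16 from Theorem 11** (the paper's Proof of Theorem 16, p19–20, with Theorem 2 /
Sikora–Varvitsiotis made explicit): a `CS_+`-factorization `{X^±_x} ⊆ H^d_+` of `P_C` gives
`K := X⁺_x + X⁻_x` independent of `x` (`tr(K_x K_y) = 1` for all `x, y`), `tr(K²) = 1`, and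
`A_x := X⁺_x − X⁻_x` with `−K ⪯ A_x ⪯ K`, `tr(A_x A_y) = c_{xy}`; compressing to the support of `K`
(`K = V D Vᴴ`, `D ≻ 0` diagonal of size `r ≤ d`) and conjugating by `D^{-1/2}` yields observables
`M_x := D^{-1/2} Vᴴ A_x V D^{-1/2}` with `−I ⪯ M_x ⪯ I`, `N_y := M_yᵀ`, and the state
`ρ := ψψ*`, `ψ := vec(D)`, with `tr((M_x ⊗ N_y)ρ) = tr(D M_x D M_y) = tr(A_x A_y) = c_{xy}`; Theorem 11
(with `C ∈ ext Cor(n,n)` by Proposition 2) gives `d ≥ r ≥ √2^{⌊rank C/2⌋}`.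
[cite: PrakashEtAl2017, Thm. 16 and its proof (p19–p20); Thm. 2 (p08)] -/
theorem PrakashEtAl2017_thm16_of_thm11 (h11 : PrakashEtAl2017_thm11) : PrakashEtAl2017_thm16 := by
  intro n hn C hC hrank
  classical
  refine ⟨isGramLorentz_behaviorMatrix hC.1, fun d hcpsd => ?_⟩
  obtain ⟨P, hPpsd, hPgram⟩ := hcpsd
  -- entries of the behavior matrix `P_C = ¼ [J+C, J−C; J−C, J+C]`
  have hB11 : ∀ x y, behaviorMatrix C (Sum.inl x) (Sum.inl y) = (1 + C x y) / 4 := fun x y => by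
    simp only [behaviorMatrix, Matrix.smul_apply, Matrix.fromBlocks_apply₁₁, Matrix.add_apply,
      Matrix.of_apply, smul_eq_mul]; ring
  have hB12 : ∀ x y, behaviorMatrix C (Sum.inl x) (Sum.inr y) = (1 - C x y) / 4 := fun x y => by
    simp only [behaviorMatrix, Matrix.smul_apply, Matrix.fromBlocks_apply₁₂, Matrix.sub_apply,
      Matrix.of_apply, smul_eq_mul]; ring
  have hB21 : ∀ x y, behaviorMatrix C (Sum.inr x) (Sum.inl y) = (1 - C x y) / 4 := fun x y => by
    simp only [behaviorMatrix, Matrix.smul_apply, Matrix.fromBlocks_apply₂₁, Matrix.sub_apply,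
      Matrix.of_apply, smul_eq_mul]; ring
  have hB22 : ∀ x y, behaviorMatrix C (Sum.inr x) (Sum.inr y) = (1 + C x y) / 4 := fun x y => by
    simp only [behaviorMatrix, Matrix.smul_apply, Matrix.fromBlocks_apply₂₂, Matrix.add_apply,
      Matrix.of_apply, smul_eq_mul]; ring
  -- the factors `X⁺_x = P (inl x)`, `X⁻_x = P (inr x)` and their trace inner products
  obtain ⟨Xp, hXp⟩ : ∃ Xp : Fin n → Matrix (Fin d) (Fin d) ℂ, Xp = fun x => P (Sum.inl x) :=
    ⟨_, rfl⟩
  obtain ⟨Xm, hXm⟩ : ∃ Xm : Fin n → Matrix (Fin d) (Fin d) ℂ, Xm = fun x => P (Sum.inr x) :=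
    ⟨_, rfl⟩
  have hXpsd : ∀ x, (Xp x).PosSemidef := fun x => by rw [hXp]; exact hPpsd _
  have hXmsd : ∀ x, (Xm x).PosSemidef := fun x => by rw [hXm]; exact hPpsd _
  have hpp : ∀ x y, (Xp x * Xp y).trace = (((1 + C x y) / 4 : ℝ) : ℂ) := fun x y => by
    rw [← hB11, hPgram, hXp]
  have hpm : ∀ x y, (Xp x * Xm y).trace = (((1 - C x y) / 4 : ℝ) : ℂ) := fun x y => by
    rw [← hB12, hPgram, hXp, hXm]
  have hmp : ∀ x y, (Xm x * Xp y).trace = (((1 - C x y) / 4 : ℝ) : ℂ) := fun x y => by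
    rw [← hB21, hPgram, hXp, hXm]
  have hmm : ∀ x y, (Xm x * Xm y).trace = (((1 + C x y) / 4 : ℝ) : ℂ) := fun x y => by
    rw [← hB22, hPgram, hXm]
  have hKK : ∀ x y, ((Xp x + Xm x) * (Xp y + Xm y)).trace = 1 := fun x y => by
    simp only [Matrix.add_mul, Matrix.mul_add, trace_add, hpp, hpm, hmp, hmm]; push_cast; ring
  have hAA : ∀ x y, ((Xp x - Xm x) * (Xp y - Xm y)).trace = ((C x y : ℝ) : ℂ) := fun x y => by
    simp only [Matrix.sub_mul, Matrix.mul_sub, trace_sub, hpp, hpm, hmp, hmm]; push_cast; ring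
  -- `K_x := X⁺_x + X⁻_x` is independent of `x`: `tr((K_x − K_{x₀})²) = 1 − 1 − 1 + 1 = 0`
  obtain ⟨K, hK⟩ : ∃ K : Matrix (Fin d) (Fin d) ℂ, K = Xp ⟨0, hn⟩ + Xm ⟨0, hn⟩ := ⟨_, rfl⟩
  have hKpsd' : ∀ x, (Xp x + Xm x).PosSemidef := fun x => (hXpsd x).add (hXmsd x)
  have hKx : ∀ x, Xp x + Xm x = K := fun x => by
    have hH : (Xp x + Xm x - K).IsHermitian := by rw [hK]; exact (hKpsd' x).1.sub (hKpsd' _).1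
    have h0 : ((Xp x + Xm x - K) * (Xp x + Xm x - K)).trace = 0 := by
      rw [hK]; simp only [Matrix.sub_mul, Matrix.mul_sub, trace_sub, hKK]; ring
    exact sub_eq_zero.mp (eq_zero_of_isHermitian_of_trace_mul_self hH h0)
  have hKpsd : K.PosSemidef := by rw [hK]; exact hKpsd' _
  have hK2 : (K * K).trace = 1 := by rw [hK]; exact hKK _ _
  -- `A_x := X⁺_x − X⁻_x`: `K ± A_x = 2 X^±_x ⪰ 0`, `tr(A_x A_y) = c_{xy}`
  obtain ⟨A, hA⟩ : ∃ A : Fin n → Matrix (Fin d) (Fin d) ℂ, A = fun x => Xp x - Xm x := ⟨_, rfl⟩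
  have hAh : ∀ x, (A x).IsHermitian := fun x => by rw [hA]; exact (hXpsd x).1.sub (hXmsd x).1
  have hKA : ∀ x, (K + A x).PosSemidef := fun x => by
    have : K + A x = Xp x + Xp x := by rw [← hKx x, hA]; dsimp only; abel
    rw [this]; exact (hXpsd x).add (hXpsd x)
  have hKA' : ∀ x, (K - A x).PosSemidef := fun x => by
    have : K - A x = Xm x + Xm x := by rw [← hKx x, hA]; dsimp only; abel
    rw [this]; exact (hXmsd x).add (hXmsd x)
  have hAA' : ∀ x y, (A x * A y).trace = ((C x y : ℝ) : ℂ) := fun x y => by rw [hA]; exact hAA x y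
  -- spectral isometry of `K`: `K = V D Vᴴ`, `D = diag(κ) ≻ 0` of size `r ≤ d`, `Vᴴ V = I_r`
  obtain ⟨r, hr, V, κ, hκ, hVV, hKV⟩ := exists_isometry_diag_of_posSemidef hKpsd
  rw [Fintype.card_fin] at hr
  obtain ⟨c, hc⟩ : ∃ c : Fin r → ℂ, c = fun a => ((κ a : ℝ) : ℂ) := ⟨_, rfl⟩
  obtain ⟨D, hD⟩ : ∃ D : Matrix (Fin r) (Fin r) ℂ, D = diagonal c := ⟨_, rfl⟩
  rw [← hc, ← hD] at hKV
  obtain ⟨Dh, hDh⟩ : ∃ Dh : Matrix (Fin r) (Fin r) ℂ,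
    Dh = diagonal fun a => ((Real.sqrt (κ a) : ℝ) : ℂ) := ⟨_, rfl⟩
  obtain ⟨E, hE⟩ : ∃ E : Matrix (Fin r) (Fin r) ℂ,
    E = diagonal fun a => (((Real.sqrt (κ a))⁻¹ : ℝ) : ℂ) := ⟨_, rfl⟩
  have hsq0 : ∀ a, Real.sqrt (κ a) ≠ 0 := fun a => (Real.sqrt_pos.mpr (hκ a)).ne'
  have hDhE : Dh * E = 1 := by
    rw [hDh, hE, diagonal_mul_diagonal, ← diagonal_one]
    congr 1; funext a
    rw [← Complex.ofReal_mul, mul_inv_cancel₀ (hsq0 a), Complex.ofReal_one]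
  have hEDh : E * Dh = 1 := by
    rw [hDh, hE, diagonal_mul_diagonal, ← diagonal_one]
    congr 1; funext a
    rw [← Complex.ofReal_mul, inv_mul_cancel₀ (hsq0 a), Complex.ofReal_one]
  have hDhDh : Dh * Dh = D := by
    rw [hDh, hD, hc, diagonal_mul_diagonal]
    congr 1; funext a
    rw [← Complex.ofReal_mul, Real.mul_self_sqrt (hκ a).le]
  have hEh : Eᴴ = E := by
    rw [hE, diagonal_conjTranspose]; congr 1; funext a; exact Complex.conj_ofReal _
  have hcstar : star c = c := by
    funext a; rw [Pi.star_apply, hc]; exact Complex.conj_ofReal _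
  have hEDE : E * D * E = 1 := by rw [← hDhDh, ← Matrix.mul_assoc, hEDh, Matrix.one_mul, hDhE]
  have hVKV : Vᴴ * K * V = D := by
    rw [hKV]; simp only [Matrix.mul_assoc]
    rw [hVV, Matrix.mul_one, ← Matrix.mul_assoc, hVV, Matrix.one_mul]
  have htrD : (D * D).trace = ∑ a, c a * c a := by
    rw [hD, diagonal_mul_diagonal, trace_diagonal]
  have htrKK : (K * K).trace = (D * D).trace := by
    have : K * K = V * (D * D) * Vᴴ := by
      rw [hKV]; simp only [Matrix.mul_assoc]; rw [← Matrix.mul_assoc Vᴴ V _, hVV, Matrix.one_mul]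
    rw [this, Matrix.trace_mul_cycle, hVV, Matrix.one_mul]
  -- support of the `A_x`
  have hsupp : ∀ x, A x * (V * Vᴴ) = A x ∧ V * Vᴴ * A x = A x := fun x => by
    have h2K : K + A x + (K - A x) = V * ((2 : ℂ) • D) * Vᴴ := by
      rw [add_add_sub_cancel, hKV, Matrix.mul_smul, Matrix.smul_mul, two_smul]
    have hX := mul_proj_eq_of_posSemidef V _ hVV (hKA x) (hKA' x) h2K
    have hKP : K * (V * Vᴴ) = K := by
      rw [hKV, Matrix.mul_assoc, ← Matrix.mul_assoc Vᴴ V _, hVV, Matrix.one_mul]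
    have hPK : V * Vᴴ * K = K := by
      rw [hKV, ← Matrix.mul_assoc, ← Matrix.mul_assoc, Matrix.mul_assoc V Vᴴ V, hVV,
        Matrix.mul_one]
    constructor
    · have h := hX.1
      rw [Matrix.add_mul, hKP] at h
      exact add_left_cancel h
    · have h := hX.2
      rw [Matrix.mul_add, hPK] at h
      exact add_left_cancel h
  -- the observables `M_x := E (Vᴴ A_x V) E`, `N_y := M_yᵀ` and the state `ρ := ψψ*`, `ψ = vec(D)`
  obtain ⟨A', hA'⟩ : ∃ A' : Fin n → Matrix (Fin r) (Fin r) ℂ, A' = fun x => Vᴴ * A x * V :=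
    ⟨_, rfl⟩
  obtain ⟨M, hM⟩ : ∃ M : Fin n → Matrix (Fin r) (Fin r) ℂ, M = fun x => E * A' x * E := ⟨_, rfl⟩
  have hA'h : ∀ x, (A' x).IsHermitian := fun x => by
    rw [hA']; exact isHermitian_conjTranspose_mul_mul V (hAh x)
  have hMh : ∀ x, (M x).IsHermitian := fun x => by
    have := isHermitian_conjTranspose_mul_mul E (hA'h x)
    rwa [hEh, hM] at *
  have hM1 : ∀ x, (1 - M x).PosSemidef := fun x => by
    have h1 : 1 - M x = Eᴴ * (Vᴴ * (K - A x) * V) * E := by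
      rw [hEh, hM, hA', ← hEDE, ← hVKV]
      simp only [Matrix.mul_sub, Matrix.sub_mul]
    rw [h1]; exact ((hKA' x).conjTranspose_mul_mul_same V).conjTranspose_mul_mul_same E
  have hM2 : ∀ x, (1 + M x).PosSemidef := fun x => by
    have h1 : 1 + M x = Eᴴ * (Vᴴ * (K + A x) * V) * E := by
      rw [hEh, hM, hA', ← hEDE, ← hVKV]
      simp only [Matrix.mul_add, Matrix.add_mul]
    rw [h1]; exact ((hKA x).conjTranspose_mul_mul_same V).conjTranspose_mul_mul_same E
  obtain ⟨ψ, hψ⟩ : ∃ ψ : Fin r × Fin r → ℂ, ψ = fun p => diagonal c p.1 p.2 := ⟨_, rfl⟩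
  have hψψ : ψ ⬝ᵥ star ψ = ∑ a, c a * c a := by
    rw [hψ]
    simp only [dotProduct, Fintype.sum_prod_type, Pi.star_apply, diagonal_apply, apply_ite star,
      star_zero, mul_ite, mul_zero, ite_mul, zero_mul, Finset.sum_ite_eq, Finset.mem_univ, if_true]
    refine Finset.sum_congr rfl fun a _ => ?_
    rw [show star (c a) = c a from congrFun hcstar a]
  -- Theorem 11 applied to `(M_x, M_yᵀ, ψψ*)` in dimension `r`
  have hCext := PrakashEtAl2017_prop2 hC
  have key := h11 n n r C hCext M (fun y => (M y)ᵀ) (vecMulVec ψ (star ψ))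
    (fun x => ⟨hMh x, hM1 x, hM2 x⟩)
    (fun y => ⟨(hMh y).transpose, by rw [← transpose_one, ← transpose_sub]; exact (hM1 y).transpose,
      by rw [← transpose_one, ← transpose_add]; exact (hM2 y).transpose⟩)
    (posSemidef_vecMulVec_self_star ψ)
    (by rw [trace_vecMulVec, hψψ, ← htrD, ← htrKK, hK2])
    (fun x y => by
      rw [hψ, trace_kronecker_mul_vecMulVec_diagonal, transpose_transpose, hcstar, ← hD]
      -- `tr(D M_x D M_y) = tr(A'_x A'_y) = tr(A_x A_y) = c_{xy}`
      have h3 : D * M x * D * M y = Dh * ((Dh * E) * A' x * (E * Dh) * (Dh * E) * A' y) * E := by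
        rw [hM, ← hDhDh]; simp only [Matrix.mul_assoc]
      rw [h3, hDhE, hEDh]
      simp only [Matrix.one_mul, Matrix.mul_one]
      rw [Matrix.trace_mul_cycle, hEDh, Matrix.one_mul, hA']
      dsimp only
      have h4 : Vᴴ * A x * V * (Vᴴ * A y * V) = Vᴴ * (A x * (V * Vᴴ) * A y) * V := by
        simp only [Matrix.mul_assoc]
      rw [h4, (hsupp x).1, Matrix.trace_mul_cycle, ← Matrix.mul_assoc, (hsupp x).2, hAA'])
  rw [hrank] at key
  exact key.trans (by exact_mod_cast hr)

/-- **PSVW Theorem 16 from Tsirelson's theorems**: composing `PrakashEtAl2017_thm16_of_thm11` with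
`PrakashEtAl2017_thm11_of_tsirelson`, the exponential cpsd-rank lower bound for the behavior matrix
of a maximal-rank extreme point of the elliptope holds modulo the two (restated, unproved here)
results of Tsirelson only. [cite: PrakashEtAl2017, Thm. 16 (p19–p20); Lemma 12, Thm. 20 (p24)] -/
theorem PrakashEtAl2017_thm16_of_tsirelson (h12 : Tsirelson1987_lemma12)
    (h20 : Tsirelson1987_thm20) : PrakashEtAl2017_thm16 :=
  PrakashEtAl2017_thm16_of_thm11 (PrakashEtAl2017_thm11_of_tsirelson h12 h20)

/-- **PSVW Result 1 from Tsirelson's theorems** (p06: "For any integer `n ≥ 1` there exists a matrix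
`X_n ∈ GL^{2n}` such that `cpsd-rank(X_n) ≥ √2^{⌊r_max(n)/2⌋}`"): by `PrakashEtAl2017_result1_of`
with Theorem 14 proved (`PrakashEtAl2017_thm14_holds`) and Theorem 16 from Tsirelson's Lemma 12 and
Theorem 20. [cite: PrakashEtAl2017, Result 1 (p06), Thm. 16 (p19)] -/
theorem PrakashEtAl2017_result1_of_tsirelson (h12 : Tsirelson1987_lemma12)
    (h20 : Tsirelson1987_thm20) (n : ℕ) (hn : 1 ≤ n) :
    ∃ X : Matrix (Fin n ⊕ Fin n) (Fin n ⊕ Fin n) ℝ, IsGramLorentz X ∧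
      ∀ d : ℕ, HasCpsdFactorization X d → Real.sqrt 2 ^ (elliptopeMaxRank n / 2) ≤ (d : ℝ) :=
  PrakashEtAl2017_result1_of_thm16 (PrakashEtAl2017_thm16_of_tsirelson h12 h20) n hn


/-- **PSVW Theorem 11 modulo Tsirelson's Theorem 20 only**: Lemma 12 is now a theorem
(`Tsirelson1987_lemma12_holds`, `TsirelsonExtremalCorrelations.lean`), so the single remaining
external input of Theorem 11 is `Tsirelson1987_thm20`. [cite: PrakashEtAl2017, Thm. 11 (p17; proof §8 p24)] -/
theorem PrakashEtAl2017_thm11_of_thm20 (h20 : Tsirelson1987_thm20) : PrakashEtAl2017_thm11 :=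
  PrakashEtAl2017_thm11_of_tsirelson Tsirelson1987_lemma12_holds h20

/-- **PSVW Theorem 16 modulo Tsirelson's Theorem 20 only.** [cite: PrakashEtAl2017, Thm. 16 (p19–p20)] -/
theorem PrakashEtAl2017_thm16_of_thm20 (h20 : Tsirelson1987_thm20) : PrakashEtAl2017_thm16 :=
  PrakashEtAl2017_thm16_of_tsirelson Tsirelson1987_lemma12_holds h20

/-- **PSVW Result 1 modulo Tsirelson's Theorem 20 only** (an explicit `2n × 2n` Gram-Lorentz matrix
with `cpsd-rank ≥ √2^{⌊r_max(n)/2⌋}` for every `n ≥ 1`). [cite: PrakashEtAl2017, Result 1 (p06), Thm. 16 (p19)] -/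
theorem PrakashEtAl2017_result1_of_thm20 (h20 : Tsirelson1987_thm20) (n : ℕ) (hn : 1 ≤ n) :
    ∃ X : Matrix (Fin n ⊕ Fin n) (Fin n ⊕ Fin n) ℝ, IsGramLorentz X ∧
      ∀ d : ℕ, HasCpsdFactorization X d → Real.sqrt 2 ^ (elliptopeMaxRank n / 2) ≤ (d : ℝ) :=
  PrakashEtAl2017_result1_of_tsirelson Tsirelson1987_lemma12_holds h20 n hn

/-! ### Unconditional forms: Theorem 11, Theorem 16, Result 1 -/

/-- **Discharge of `PrakashEtAl2017_thm11`** (PSVW Theorem 11: an irreducible quantum representation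
of `C ∈ ext(Cor(n,m))` has dimension `d ≥ √2^{⌊rank C/2⌋}`): both Tsirelson inputs are now
theorems (`Tsirelson1987_lemma12_holds`, `Tsirelson1987_thm20_holds`).
[cite: PrakashEtAl2017, Thm. 11 (p17), Proof 21 (p24)] -/
theorem PrakashEtAl2017_thm11_holds : PrakashEtAl2017_thm11 :=
  PrakashEtAl2017_thm11_of_thm20 Tsirelson1987_thm20_holds

/-- **Discharge of `PrakashEtAl2017_thm16`** (PSVW MAIN Theorem 16: `cpsd-rank(P_C) ≥ √2^{⌊r_max(n)/2⌋}`
for extreme `C ∈ 𝓔_n` of maximal rank). [cite: PrakashEtAl2017, Thm. 16 (p19–p20)] -/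
theorem PrakashEtAl2017_thm16_holds : PrakashEtAl2017_thm16 :=
  PrakashEtAl2017_thm16_of_thm20 Tsirelson1987_thm20_holds

/-- **PSVW Result 1, unconditional** (p06: "For any integer `n ≥ 1` there exists a matrix
`X ∈ CS_+^{2n}` … with `cpsd-rank(X) ≥ √2^{⌊r_max(n)/2⌋}`", here with the explicit Gram-Lorentz
witness of Theorem 16). [cite: PrakashEtAl2017, Result 1 (p06), Thm. 16 (p19)] -/
theorem PrakashEtAl2017_result1 (n : ℕ) (hn : 1 ≤ n) :
    ∃ X : Matrix (Fin n ⊕ Fin n) (Fin n ⊕ Fin n) ℝ, IsGramLorentz X ∧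
      ∀ d : ℕ, HasCpsdFactorization X d → Real.sqrt 2 ^ (elliptopeMaxRank n / 2) ≤ (d : ℝ) :=
  PrakashEtAl2017_result1_of_thm20 Tsirelson1987_thm20_holds n hn

end Thm16

/-! ### Gribling–de Laat–Laurent 2017, Theorem 4.4 / Corollary 4.5: the two-sided bound (appended)

S. Gribling, D. de Laat, M. Laurent, *Matrices with high completely positive semidefinite rank*,
Linear Algebra Appl. 513 (2017) 122–148 = arXiv:1605.00988 [GriblingDelaatLaurent2017], §4 (held
text `paper:arxiv-1605.00988`, chunks p13–p15). Theorem 4.4 (p14, verbatim): "Let `C` be an extreme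
point of `Cor(m,n)` and let `r = rank(C)`. Every commuting operator representation of `C` uses matrices
of size at least `(2^{⌊r/2⌋})²`." Corollary 4.5 (p15): "The minimum local dimension of a tensor
operator representation of `C` is `2^{⌊r/2⌋}`." This SQUARES PSVW Theorem 11's bound
`d ≥ √2^{⌊r/2⌋}`: the printed proof runs PSVW's Proof 21 on BOTH sides — Tsirelson's Theorem 4.3
(= PSVW Theorem 20, `Tsirelson1987_thm20_holds`) makes `{A_x}` AND `{B_y}` Clifford, the two Clifford
families commute, "each irreducible representation of `𝒞(r) ⊗ 𝒞(r)` is the tensor product of two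
irreducible representations of `𝒞(r)`", so the dimension is divisible by `(2^{⌊r/2⌋})²`
(`Literature.LinearAlgebra.two_pow_mul_two_pow_dvd_of_anticommutator_eq_gram_of_commute`). A
commuting operator representation is typed exactly as hypotheses (i)–(iv) of `Tsirelson1987_thm20`;
a tensor operator representation as the hypotheses of `PrakashEtAl2017_thm11` (PSVW allow a mixed
state `ρ`, which is more general than GdLL's unit vector `ψ`).
-/

section GdLL44

variable {n m : ℕ}

/-- **GdLL Theorem 4.4** (p14, verbatim): "Let `C` be an extreme point of `Cor(m,n)` and let
`r = rank(C)`. Every commuting operator representation of `C` uses matrices of size at least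
`(2^{⌊r/2⌋})²`." A commuting operator representation (p13: Hermitian `X_s, Y_t` with spectra in
`[−1,1]`, `X_sY_t = Y_tX_s`, a psd `W` of trace one, `C_{s,t} = Tr(X_sY_tW)`) is typed as hypotheses
(i)–(iv) of `Tsirelson1987_thm20` on a finite index type `σ` (size `|σ|`). Proof as printed: pass to
a nondegenerate representation of minimal size `D' ≤ |σ|` (`isRep_compress`), Lemma 12 puts a
`C`-system in `ℝ^τ` with both families spanning, Theorem 20 (= GdLL Theorem 4.3) gives the two
commuting Clifford families, and the two-sided Clifford bound gives `(2^{⌊τ/2⌋})² ∣ D'`; finally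
`rank C ≤ τ`. [cite: GriblingDelaatLaurent2017, Thm. 4.4 (p14–p15)] -/
theorem GriblingDelaatLaurent2017_thm44 {σ : Type} [Fintype σ] [DecidableEq σ]
    {C : Matrix (Fin n) (Fin m) ℝ} (hC : C ∈ Set.extremePoints ℝ (quantumCorrelations n m))
    (A : Fin n → Matrix σ σ ℂ) (B : Fin m → Matrix σ σ ℂ) (ρ : Matrix σ σ ℂ)
    (hc : ∀ x y, ((C x y : ℝ) : ℂ) = (A x * B y * ρ).trace)
    (hcomm : ∀ x y, A x * B y = B y * A x) (hρ : ρ.PosSemidef) (hρ1 : ρ.trace = 1)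
    (hA : ∀ x, (A x).IsHermitian ∧ (1 - A x).PosSemidef ∧ (1 + A x).PosSemidef)
    (hB : ∀ y, (B y).IsHermitian ∧ (1 - B y).PosSemidef ∧ (1 + B y).PosSemidef) :
    2 ^ (C.rank / 2) * 2 ^ (C.rank / 2) ≤ Fintype.card σ := by
  classical
  -- `|σ| ≥ 1` since `tr ρ = 1`
  have hd : 1 ≤ Fintype.card σ := by
    by_contra h0
    have h0' : Fintype.card σ = 0 := by omega
    haveI : IsEmpty σ := Fintype.card_eq_zero_iff.mp h0'
    have : ρ.trace = 0 := by simp [Matrix.trace]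
    exact zero_ne_one (this.symm.trans hρ1)
  -- degenerate Bell scenarios (`n = 0` or `m = 0`): `rank C = 0`
  have htriv : C.rank = 0 → 2 ^ (C.rank / 2) * 2 ^ (C.rank / 2) ≤ Fintype.card σ := fun h0 => by
    rw [h0, Nat.zero_div, pow_zero, mul_one]
    exact hd
  rcases Nat.eq_zero_or_pos n with hn0 | hn
  · subst hn0
    exact htriv (Nat.le_zero.mp ((Matrix.rank_le_card_height C).trans (by simp)))
  rcases Nat.eq_zero_or_pos m with hm0 | hm
  · subst hm0
    exact htriv (Nat.le_zero.mp ((Matrix.rank_le_card_width C).trans (by simp)))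
  -- representations of `C` satisfying (i)–(iv), by dimension
  let Q : ℕ → Prop := fun r => ∃ (σ' : Type) (_ : Fintype σ') (_ : DecidableEq σ'),
    Fintype.card σ' = r ∧ ∃ (A' : Fin n → Matrix σ' σ' ℂ) (B' : Fin m → Matrix σ' σ' ℂ)
      (ρ' : Matrix σ' σ' ℂ),
      ((∀ x y, ((C x y : ℝ) : ℂ) = (A' x * B' y * ρ').trace) ∧
      (∀ x y, A' x * B' y = B' y * A' x) ∧ ρ'.PosSemidef ∧ ρ'.trace = 1 ∧
      (∀ x, (A' x).IsHermitian ∧ (1 - A' x).PosSemidef ∧ (1 + A' x).PosSemidef) ∧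
      (∀ y, (B' y).IsHermitian ∧ (1 - B' y).PosSemidef ∧ (1 + B' y).PosSemidef))
  have hQd : Q (Fintype.card σ) := ⟨σ, inferInstance, inferInstance, rfl, A, B, ρ,
    hc, hcomm, hρ, hρ1, hA, hB⟩
  have hQ : ∃ r, Q r := ⟨_, hQd⟩
  obtain ⟨σ', _, _, hcard, A', B', ρ', hrep⟩ := Nat.find_spec hQ
  have hmin : ∀ r, r < Nat.find hQ → ¬ Q r := fun r hr => Nat.find_min hQ hr
  have hle : Nat.find hQ ≤ Fintype.card σ := Nat.find_min' hQ hQd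
  -- the minimal representation is nondegenerate, condition (v)
  have hv : ¬ ∃ P : Matrix σ' σ' ℂ, P.IsHermitian ∧ P * P = P ∧ P ≠ 1 ∧
      (∀ x, P * A' x = A' x * P) ∧ (∀ y, P * B' y = B' y * P) ∧ P * ρ' * P = ρ' := by
    rintro ⟨P, hPh, hPP, hP1, hPA, hPB, hPρ⟩
    obtain ⟨r, hr, A'', B'', ρ'', hrep'⟩ := isRep_compress hrep hPh hPP hP1 hPA hPB hPρ
    exact hmin r (hcard ▸ hr) ⟨Fin r, inferInstance, inferInstance, Fintype.card_fin r, A'', B'',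
      ρ'', hrep'⟩
  -- it has positive dimension (`tr ρ' = 1`)
  have hpos : 0 < Nat.find hQ := by
    rw [← hcard]
    by_contra h0
    have h0' : Fintype.card σ' = 0 := by omega
    haveI : IsEmpty σ' := Fintype.card_eq_zero_iff.mp h0'
    have : ρ'.trace = 0 := by simp [Matrix.trace]
    exact zero_ne_one (this.symm.trans hrep.2.2.2.1)
  -- a `C`-system in `ℝ^τ` (Lemma 12), both families spanning
  obtain ⟨hspan, τ, hτ1, hdimτ⟩ := Tsirelson1987_lemma12_holds n m C hn hm hC
  obtain ⟨u0, v0, hu0, hv0, hCuv⟩ := hC.1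
  have hsys0 : IsCSystem C u0 v0 := ⟨fun x => (hu0 x).le, fun y => (hv0 y).le, hCuv⟩
  let W : Submodule ℝ (EuclideanSpace ℝ (Fin (n + m))) := Submodule.span ℝ (Set.range u0)
  have hW : Module.finrank ℝ W = τ := hdimτ _ u0 v0 hsys0
  let φ : W ≃ₗᵢ[ℝ] EuclideanSpace ℝ (Fin τ) := ((stdOrthonormalBasis ℝ W).reindex (finCongr hW)).repr
  have huW : ∀ x, u0 x ∈ W := fun x => Submodule.subset_span ⟨x, rfl⟩
  have hvW : ∀ y, v0 y ∈ W := fun y => by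
    show v0 y ∈ Submodule.span ℝ (Set.range u0)
    rw [hspan _ u0 v0 hsys0]
    exact Submodule.subset_span ⟨y, rfl⟩
  let u : Fin n → EuclideanSpace ℝ (Fin τ) := fun x => φ ⟨u0 x, huW x⟩
  let v : Fin m → EuclideanSpace ℝ (Fin τ) := fun y => φ ⟨v0 y, hvW y⟩
  have hsys : IsCSystem C u v := by
    refine ⟨fun x => ?_, fun y => ?_, fun x y => ?_⟩
    · simp only [u, LinearIsometryEquiv.norm_map]
      exact (hu0 x).le
    · simp only [v, LinearIsometryEquiv.norm_map]
      exact (hv0 y).le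
    · simp only [u, v, LinearIsometryEquiv.inner_map_map, Submodule.coe_inner]
      exact hCuv x y
  have hspan_u : Submodule.span ℝ (Set.range u) = ⊤ := by
    apply Submodule.eq_top_of_finrank_eq
    rw [finrank_euclideanSpace_fin]
    exact hdimτ _ u v hsys
  have hspan_v : Submodule.span ℝ (Set.range v) = ⊤ := by
    rw [← hspan _ u v hsys]
    exact hspan_u
  -- Theorem 20 (= GdLL Theorem 4.3) on the minimal representation: both families are Clifford
  obtain ⟨hAA, hBB⟩ := Tsirelson1987_thm20_holds n m σ' C hn hm hC A' B' ρ' hrep.1 hrep.2.1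
    hrep.2.2.1 hrep.2.2.2.1 hrep.2.2.2.2.1 hrep.2.2.2.2.2 hv τ u v hsys
  -- bases among the `u_x` and among the `v_y`, with nonsingular Gram matrices
  obtain ⟨e, he⟩ := exists_linearIndependent_subfamily u hspan_u
  obtain ⟨e', he'⟩ := exists_linearIndependent_subfamily v hspan_v
  let G : Matrix (Fin τ) (Fin τ) ℝ := Matrix.of fun k k' => inner ℝ (u (e k)) (u (e k'))
  let G' : Matrix (Fin τ) (Fin τ) ℝ := Matrix.of fun k k' => inner ℝ (v (e' k)) (v (e' k'))
  have hGsym : G.IsSymm := by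
    ext k k'
    simp only [G, Matrix.transpose_apply, Matrix.of_apply]
    exact real_inner_comm _ _
  have hG'sym : G'.IsSymm := by
    ext k k'
    simp only [G', Matrix.transpose_apply, Matrix.of_apply]
    exact real_inner_comm _ _
  have hGdet : G.det ≠ 0 := det_gram_ne_zero he
  have hG'det : G'.det ≠ 0 := det_gram_ne_zero he'
  -- transport to `Fin D'` and apply the two-sided Clifford dimension bound
  let eσ : σ' ≃ Fin (Nat.find hQ) := Fintype.equivFinOfCardEq hcard
  let ψ := Matrix.reindexAlgEquiv ℂ ℂ eσ
  have hrelA : ∀ k k', ψ (A' (e k)) * ψ (A' (e k')) + ψ (A' (e k')) * ψ (A' (e k)) =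
      ((2 * G k k' : ℝ) : ℂ) • (1 : Matrix (Fin (Nat.find hQ)) (Fin (Nat.find hQ)) ℂ) := by
    intro k k'
    rw [← map_mul, ← map_mul, ← map_add, hAA, map_smul, map_one]
    rfl
  have hrelB : ∀ k k', ψ (B' (e' k)) * ψ (B' (e' k')) + ψ (B' (e' k')) * ψ (B' (e' k)) =
      ((2 * G' k k' : ℝ) : ℂ) • (1 : Matrix (Fin (Nat.find hQ)) (Fin (Nat.find hQ)) ℂ) := by
    intro k k'
    rw [← map_mul, ← map_mul, ← map_add, hBB, map_smul, map_one]
    rfl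
  have hrelAB : ∀ k k', ψ (A' (e k)) * ψ (B' (e' k')) = ψ (B' (e' k')) * ψ (A' (e k)) := by
    intro k k'
    rw [← map_mul, ← map_mul, hrep.2.1]
  have hdvd := Literature.LinearAlgebra.two_pow_mul_two_pow_dvd_of_anticommutator_eq_gram_of_commute
    (fun k => ψ (A' (e k))) (fun k => ψ (B' (e' k))) G hGsym hGdet G' hG'sym hG'det hrelA hrelB hrelAB
  -- numerics: `(2^{⌊rank C/2⌋})² ≤ (2^{⌊τ/2⌋})² ≤ D' ≤ |σ|`
  have hrank : C.rank ≤ τ := rank_le_of_isCSystem hsys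
  have hmono : 2 ^ (C.rank / 2) ≤ 2 ^ (τ / 2) :=
    Nat.pow_le_pow_right (by norm_num) (Nat.div_le_div_right hrank)
  calc 2 ^ (C.rank / 2) * 2 ^ (C.rank / 2) ≤ 2 ^ (τ / 2) * 2 ^ (τ / 2) :=
        Nat.mul_le_mul hmono hmono
    _ ≤ Nat.find hQ := Nat.le_of_dvd hpos hdvd
    _ ≤ Fintype.card σ := hle

/-- **GdLL Corollary 4.5, lower-bound half** (p15: "The minimum local dimension of a tensor operator
representation of `C` is `2^{⌊r/2⌋}`"), in the format of `PrakashEtAl2017_thm11` (observables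
`M_x ⊗ I`, `I ⊗ N_y` on `ℂ^d ⊗ ℂ^d`, a state `ρ` — a mixed state is allowed, as in PSVW): if `C` is an
extreme point of `Cor(n,m)` then `d ≥ 2^{⌊rank(C)/2⌋}` (the square root of Theorem 4.4's bound for the
commuting representation `{M_x ⊗ I}, {I ⊗ N_y}` of size `d²`, `isRep_kronecker`). This squares PSVW
Theorem 11 (`√2^{⌊rank C/2⌋} ≤ d`). [cite: GriblingDelaatLaurent2017, Cor. 4.5 (p15), Thm. 4.4 (p14)] -/
theorem GriblingDelaatLaurent2017_cor45 {d : ℕ} {C : Matrix (Fin n) (Fin m) ℝ}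
    (hC : C ∈ Set.extremePoints ℝ (quantumCorrelations n m))
    (M : Fin n → Matrix (Fin d) (Fin d) ℂ) (N : Fin m → Matrix (Fin d) (Fin d) ℂ)
    (ρ : Matrix (Fin d × Fin d) (Fin d × Fin d) ℂ)
    (hM : ∀ x, (M x).IsHermitian ∧ (1 - M x).PosSemidef ∧ (1 + M x).PosSemidef)
    (hN : ∀ y, (N y).IsHermitian ∧ (1 - N y).PosSemidef ∧ (1 + N y).PosSemidef)
    (hρ : ρ.PosSemidef) (hρ1 : ρ.trace = 1)
    (hc : ∀ x y, ((C x y : ℝ) : ℂ) = ((M x ⊗ₖ N y) * ρ).trace) :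
    2 ^ (C.rank / 2) ≤ d := by
  classical
  obtain ⟨h1, h2, h3, h4, h5, h6⟩ := isRep_kronecker C M N ρ hM hN hρ hρ1 hc
  have h := GriblingDelaatLaurent2017_thm44 hC _ _ ρ h1 h2 h3 h4 h5 h6
  rw [Fintype.card_prod, Fintype.card_fin] at h
  exact Nat.mul_self_le_mul_self_iff.mp h

end GdLL44

/-! ### GdLL Theorem 5.1 / Lemma 5.2 (lower-bound direction): from a `CS_+`-factorization of the
`¼(1 ± ⟨·,·⟩)` table back to a tensor operator representation (appended)

GdLL §5 (held text chunk p16). Theorem 5.1 (after Sikora–Varvitsiotis [Antonios:2015], = PSVW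
Theorem 2): a quantum correlation `p(a,b|s,t)` is realizable in local dimension `d` iff there is a
completely positive semidefinite matrix `M` indexed by `(A × S) ⊔ (B × T)` with `cpsd-rank_ℂ(M) ≤ d`,
`M_{(a,s),(b,t)} = p(a,b|s,t)` and the marginal identities
`Σ_{a,b} M_{(a,s),(b,t)} = Σ_{a,a'} M_{(a,s),(a',s')} = Σ_{b,b'} M_{(b,t),(b',t')} = 1`. Lemma 5.2: from a
bipartite correlation `C` with observables `X_s, Y_t` one forms the POVMs `X_s^a = (I + (−1)^a X_s)/2`,
`Y_t^b = (I + (−1)^b Y_t)/2`, and conversely `X̃_s = X̃_s^0 − X̃_s^1` recovers a tensor operator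
representation of `C` from any realization of `p`. What the proof of Theorem 1.1 USES is the
composite "⇐" direction, typed here concretely for the tables that arise, `M_{(a,z),(a',z')} =
¼(1 + (−1)^a(−1)^{a'} G_{zz'})` (`z, z' ∈ S ⊔ T`, `G` any real matrix — in the application the Gram
matrix of a `C`-system): a `CS_+`-factorization of size `d` of such a table yields a tensor operator
representation of the `S × T` block of `G` in local dimension `≤ d`. The argument is PSVW's proof of
Theorem 16 (made explicit in `PrakashEtAl2017_thm16_of_thm11` above) run with two sides:
`K := P_{(0,s)} + P_{(1,s)} = P_{(0,t)} + P_{(1,t)}` is independent of the index (all pairwise trace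
inner products of these sums equal `1`), `A_s := P_{(0,s)} − P_{(1,s)}`, `B_t := P_{(0,t)} − P_{(1,t)}`
satisfy `−K ⪯ A_s, B_t ⪯ K`, `tr(A_sB_t) = G_{st}`, and compressing to the support of `K = VDVᴴ` gives
`M_s = D^{-1/2}VᴴA_sVD^{-1/2}`, `N_t = (D^{-1/2}VᴴB_tVD^{-1/2})ᵀ`, `ψ = vec(D)`.
-/

section GdLL5

variable {n m : ℕ}

/-- **GdLL Theorem 5.1 "⇐" with Lemma 5.2** (p16), concretely: a `CS_+`-factorization `{P_{(a,z)}}`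
of size `d` of the table `¼(1 + (−1)^a(−1)^{a'}G_{zz'})` (`a, a' ∈ {0,1}` coded by `Bool` with
`(−1)^a := bif a then −1 else 1`; `z, z' ∈ S ⊔ T`, `|S| ≥ 1`) yields Hermitian `M_s, N_t` with `−I ⪯ M_s, N_t ⪯ I` on
`ℂ^r`, `r ≤ d`, and a state `ρ` on `ℂ^r ⊗ ℂ^r` with `G_{st} = Tr((M_s ⊗ N_t)ρ)` for `s ∈ S`, `t ∈ T` — a
tensor operator representation of the off-diagonal block in local dimension `≤ d` (PSVW's compression,
see the section docstring). [cite: GriblingDelaatLaurent2017, Thm. 5.1 and Lemma 5.2 (p16);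
PrakashEtAl2017, Thm. 2 (p08) and proof of Thm. 16 (p19–p20)] -/
theorem exists_tensorRep_of_cpsdFactorization_quarterTable {d : ℕ} (hn : 0 < n)
    (G : Matrix (Fin n ⊕ Fin m) (Fin n ⊕ Fin m) ℝ)
    (P : Bool × (Fin n ⊕ Fin m) → Matrix (Fin d) (Fin d) ℂ) (hPpsd : ∀ i, (P i).PosSemidef)
    (hPgram : ∀ a z a' z', (P (a, z) * P (a', z')).trace =
      ((((1 + (bif a then -1 else 1) * (bif a' then -1 else 1) * G z z') / 4 : ℝ)) : ℂ)) :
    ∃ r : ℕ, r ≤ d ∧ ∃ (M : Fin n → Matrix (Fin r) (Fin r) ℂ) (N : Fin m → Matrix (Fin r) (Fin r) ℂ)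
      (ρ : Matrix (Fin r × Fin r) (Fin r × Fin r) ℂ),
      (∀ x, (M x).IsHermitian ∧ (1 - M x).PosSemidef ∧ (1 + M x).PosSemidef) ∧
      (∀ y, (N y).IsHermitian ∧ (1 - N y).PosSemidef ∧ (1 + N y).PosSemidef) ∧
      ρ.PosSemidef ∧ ρ.trace = 1 ∧
      ∀ x y, (((G (Sum.inl x) (Sum.inr y)) : ℝ) : ℂ) = ((M x ⊗ₖ N y) * ρ).trace := by
  classical
  -- the four families of factors and their trace inner products
  obtain ⟨Xp, hXp⟩ : ∃ Xp : Fin n ⊕ Fin m → Matrix (Fin d) (Fin d) ℂ, Xp = fun z => P (false, z) :=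
    ⟨_, rfl⟩
  obtain ⟨Xm, hXm⟩ : ∃ Xm : Fin n ⊕ Fin m → Matrix (Fin d) (Fin d) ℂ, Xm = fun z => P (true, z) :=
    ⟨_, rfl⟩
  have hXpsd : ∀ z, (Xp z).PosSemidef := fun z => by rw [hXp]; exact hPpsd _
  have hXmsd : ∀ z, (Xm z).PosSemidef := fun z => by rw [hXm]; exact hPpsd _
  have hpp : ∀ z z', (Xp z * Xp z').trace = (((1 + G z z') / 4 : ℝ) : ℂ) := fun z z' => by
    rw [hXp]; dsimp only; rw [hPgram]; simp only [cond_false]; push_cast; ring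
  have hpm : ∀ z z', (Xp z * Xm z').trace = (((1 - G z z') / 4 : ℝ) : ℂ) := fun z z' => by
    rw [hXp, hXm]; dsimp only; rw [hPgram]; simp only [cond_true, cond_false]; push_cast; ring
  have hmp : ∀ z z', (Xm z * Xp z').trace = (((1 - G z z') / 4 : ℝ) : ℂ) := fun z z' => by
    rw [hXp, hXm]; dsimp only; rw [hPgram]; simp only [cond_true, cond_false]; push_cast; ring
  have hmm : ∀ z z', (Xm z * Xm z').trace = (((1 + G z z') / 4 : ℝ) : ℂ) := fun z z' => by
    rw [hXm]; dsimp only; rw [hPgram]; simp only [cond_true]; push_cast; ring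
  have hKK : ∀ z z', ((Xp z + Xm z) * (Xp z' + Xm z')).trace = 1 := fun z z' => by
    simp only [Matrix.add_mul, Matrix.mul_add, trace_add, hpp, hpm, hmp, hmm]; push_cast; ring
  have hAA : ∀ z z', ((Xp z - Xm z) * (Xp z' - Xm z')).trace = ((G z z' : ℝ) : ℂ) := fun z z' => by
    simp only [Matrix.sub_mul, Matrix.mul_sub, trace_sub, hpp, hpm, hmp, hmm]; push_cast; ring
  -- `K_z := P_{(0,z)} + P_{(1,z)}` is independent of `z`: `tr((K_z − K_{z₀})²) = 1 − 1 − 1 + 1 = 0`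
  obtain ⟨K, hK⟩ : ∃ K : Matrix (Fin d) (Fin d) ℂ, K = Xp (Sum.inl ⟨0, hn⟩) + Xm (Sum.inl ⟨0, hn⟩) :=
    ⟨_, rfl⟩
  have hKpsd' : ∀ z, (Xp z + Xm z).PosSemidef := fun z => (hXpsd z).add (hXmsd z)
  have hKz : ∀ z, Xp z + Xm z = K := fun z => by
    have hH : (Xp z + Xm z - K).IsHermitian := by rw [hK]; exact (hKpsd' z).1.sub (hKpsd' _).1
    have h0 : ((Xp z + Xm z - K) * (Xp z + Xm z - K)).trace = 0 := by
      rw [hK]; simp only [Matrix.sub_mul, Matrix.mul_sub, trace_sub, hKK]; ring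
    exact sub_eq_zero.mp (eq_zero_of_isHermitian_of_trace_mul_self hH h0)
  have hKpsd : K.PosSemidef := by rw [hK]; exact hKpsd' _
  have hK2 : (K * K).trace = 1 := by rw [hK]; exact hKK _ _
  -- `A_z := P_{(0,z)} − P_{(1,z)}`: `K ± A_z = 2 P_{(·,z)} ⪰ 0`, `tr(A_z A_{z'}) = G_{zz'}`
  obtain ⟨A, hA⟩ : ∃ A : Fin n ⊕ Fin m → Matrix (Fin d) (Fin d) ℂ, A = fun z => Xp z - Xm z :=
    ⟨_, rfl⟩
  have hAh : ∀ z, (A z).IsHermitian := fun z => by rw [hA]; exact (hXpsd z).1.sub (hXmsd z).1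
  have hKA : ∀ z, (K + A z).PosSemidef := fun z => by
    have : K + A z = Xp z + Xp z := by rw [← hKz z, hA]; dsimp only; abel
    rw [this]; exact (hXpsd z).add (hXpsd z)
  have hKA' : ∀ z, (K - A z).PosSemidef := fun z => by
    have : K - A z = Xm z + Xm z := by rw [← hKz z, hA]; dsimp only; abel
    rw [this]; exact (hXmsd z).add (hXmsd z)
  have hAA' : ∀ z z', (A z * A z').trace = ((G z z' : ℝ) : ℂ) := fun z z' => by rw [hA]; exact hAA z z'
  -- spectral isometry of `K`: `K = V D Vᴴ`, `D = diag(κ) ≻ 0` of size `r ≤ d`, `Vᴴ V = I_r`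
  obtain ⟨r, hr, V, κ, hκ, hVV, hKV⟩ := exists_isometry_diag_of_posSemidef hKpsd
  rw [Fintype.card_fin] at hr
  obtain ⟨c, hc⟩ : ∃ c : Fin r → ℂ, c = fun a => ((κ a : ℝ) : ℂ) := ⟨_, rfl⟩
  obtain ⟨D, hD⟩ : ∃ D : Matrix (Fin r) (Fin r) ℂ, D = diagonal c := ⟨_, rfl⟩
  rw [← hc, ← hD] at hKV
  obtain ⟨Dh, hDh⟩ : ∃ Dh : Matrix (Fin r) (Fin r) ℂ,
    Dh = diagonal fun a => ((Real.sqrt (κ a) : ℝ) : ℂ) := ⟨_, rfl⟩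
  obtain ⟨E, hE⟩ : ∃ E : Matrix (Fin r) (Fin r) ℂ,
    E = diagonal fun a => (((Real.sqrt (κ a))⁻¹ : ℝ) : ℂ) := ⟨_, rfl⟩
  have hsq0 : ∀ a, Real.sqrt (κ a) ≠ 0 := fun a => (Real.sqrt_pos.mpr (hκ a)).ne'
  have hDhE : Dh * E = 1 := by
    rw [hDh, hE, diagonal_mul_diagonal, ← diagonal_one]
    congr 1; funext a
    rw [← Complex.ofReal_mul, mul_inv_cancel₀ (hsq0 a), Complex.ofReal_one]
  have hEDh : E * Dh = 1 := by
    rw [hDh, hE, diagonal_mul_diagonal, ← diagonal_one]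
    congr 1; funext a
    rw [← Complex.ofReal_mul, inv_mul_cancel₀ (hsq0 a), Complex.ofReal_one]
  have hDhDh : Dh * Dh = D := by
    rw [hDh, hD, hc, diagonal_mul_diagonal]
    congr 1; funext a
    rw [← Complex.ofReal_mul, Real.mul_self_sqrt (hκ a).le]
  have hEh : Eᴴ = E := by
    rw [hE, diagonal_conjTranspose]; congr 1; funext a; exact Complex.conj_ofReal _
  have hcstar : star c = c := by
    funext a; rw [Pi.star_apply, hc]; exact Complex.conj_ofReal _
  have hEDE : E * D * E = 1 := by rw [← hDhDh, ← Matrix.mul_assoc, hEDh, Matrix.one_mul, hDhE]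
  have hVKV : Vᴴ * K * V = D := by
    rw [hKV]; simp only [Matrix.mul_assoc]
    rw [hVV, Matrix.mul_one, ← Matrix.mul_assoc, hVV, Matrix.one_mul]
  have htrD : (D * D).trace = ∑ a, c a * c a := by
    rw [hD, diagonal_mul_diagonal, trace_diagonal]
  have htrKK : (K * K).trace = (D * D).trace := by
    have : K * K = V * (D * D) * Vᴴ := by
      rw [hKV]; simp only [Matrix.mul_assoc]; rw [← Matrix.mul_assoc Vᴴ V _, hVV, Matrix.one_mul]
    rw [this, Matrix.trace_mul_cycle, hVV, Matrix.one_mul]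
  -- support of the `A_z`
  have hsupp : ∀ z, A z * (V * Vᴴ) = A z ∧ V * Vᴴ * A z = A z := fun z => by
    have h2K : K + A z + (K - A z) = V * ((2 : ℂ) • D) * Vᴴ := by
      rw [add_add_sub_cancel, hKV, Matrix.mul_smul, Matrix.smul_mul, two_smul]
    have hX := mul_proj_eq_of_posSemidef V _ hVV (hKA z) (hKA' z) h2K
    have hKP : K * (V * Vᴴ) = K := by
      rw [hKV, Matrix.mul_assoc, ← Matrix.mul_assoc Vᴴ V _, hVV, Matrix.one_mul]
    have hPK : V * Vᴴ * K = K := by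
      rw [hKV, ← Matrix.mul_assoc, ← Matrix.mul_assoc, Matrix.mul_assoc V Vᴴ V, hVV,
        Matrix.mul_one]
    constructor
    · have h := hX.1
      rw [Matrix.add_mul, hKP] at h
      exact add_left_cancel h
    · have h := hX.2
      rw [Matrix.mul_add, hPK] at h
      exact add_left_cancel h
  -- the observables `O_z := E (Vᴴ A_z V) E` (`M_s := O_s`, `N_t := O_tᵀ`), the state `ψψ*`, `ψ = vec(D)`
  obtain ⟨A', hA'⟩ : ∃ A' : Fin n ⊕ Fin m → Matrix (Fin r) (Fin r) ℂ, A' = fun z => Vᴴ * A z * V :=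
    ⟨_, rfl⟩
  obtain ⟨O, hO⟩ : ∃ O : Fin n ⊕ Fin m → Matrix (Fin r) (Fin r) ℂ, O = fun z => E * A' z * E :=
    ⟨_, rfl⟩
  have hA'h : ∀ z, (A' z).IsHermitian := fun z => by
    rw [hA']; exact isHermitian_conjTranspose_mul_mul V (hAh z)
  have hOh : ∀ z, (O z).IsHermitian := fun z => by
    have := isHermitian_conjTranspose_mul_mul E (hA'h z)
    rwa [hEh, hO] at *
  have hO1 : ∀ z, (1 - O z).PosSemidef := fun z => by
    have h1 : 1 - O z = Eᴴ * (Vᴴ * (K - A z) * V) * E := by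
      rw [hEh, hO, hA', ← hEDE, ← hVKV]
      simp only [Matrix.mul_sub, Matrix.sub_mul]
    rw [h1]; exact ((hKA' z).conjTranspose_mul_mul_same V).conjTranspose_mul_mul_same E
  have hO2 : ∀ z, (1 + O z).PosSemidef := fun z => by
    have h1 : 1 + O z = Eᴴ * (Vᴴ * (K + A z) * V) * E := by
      rw [hEh, hO, hA', ← hEDE, ← hVKV]
      simp only [Matrix.mul_add, Matrix.add_mul]
    rw [h1]; exact ((hKA z).conjTranspose_mul_mul_same V).conjTranspose_mul_mul_same E
  obtain ⟨ψ, hψ⟩ : ∃ ψ : Fin r × Fin r → ℂ, ψ = fun p => diagonal c p.1 p.2 := ⟨_, rfl⟩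
  have hψψ : ψ ⬝ᵥ star ψ = ∑ a, c a * c a := by
    rw [hψ]
    simp only [dotProduct, Fintype.sum_prod_type, Pi.star_apply, diagonal_apply, apply_ite star,
      star_zero, mul_ite, mul_zero, ite_mul, zero_mul, Finset.sum_ite_eq, Finset.mem_univ, if_true]
    refine Finset.sum_congr rfl fun a _ => ?_
    rw [show star (c a) = c a from congrFun hcstar a]
  refine ⟨r, hr, fun x => O (Sum.inl x), fun y => (O (Sum.inr y))ᵀ, vecMulVec ψ (star ψ),
    fun x => ⟨hOh _, hO1 _, hO2 _⟩,
    fun y => ⟨(hOh _).transpose, by rw [← transpose_one, ← transpose_sub]; exact (hO1 _).transpose,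
      by rw [← transpose_one, ← transpose_add]; exact (hO2 _).transpose⟩,
    posSemidef_vecMulVec_self_star ψ, by rw [trace_vecMulVec, hψψ, ← htrD, ← htrKK, hK2],
    fun x y => ?_⟩
  rw [hψ, trace_kronecker_mul_vecMulVec_diagonal, transpose_transpose, hcstar, ← hD]
  -- `tr(D O_s D O_t) = tr(A'_s A'_t) = tr(A_s A_t) = G_{st}`
  have h3 : D * O (Sum.inl x) * D * O (Sum.inr y) =
      Dh * ((Dh * E) * A' (Sum.inl x) * (E * Dh) * (Dh * E) * A' (Sum.inr y)) * E := by
    rw [hO, ← hDhDh]; simp only [Matrix.mul_assoc]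
  rw [h3, hDhE, hEDh]
  simp only [Matrix.one_mul, Matrix.mul_one]
  rw [Matrix.trace_mul_cycle, hEDh, Matrix.one_mul, hA']
  dsimp only
  have h4 : Vᴴ * A (Sum.inl x) * V * (Vᴴ * A (Sum.inr y) * V) =
      Vᴴ * (A (Sum.inl x) * (V * Vᴴ) * A (Sum.inr y)) * V := by
    simp only [Matrix.mul_assoc]
  rw [h4, (hsupp _).1, Matrix.trace_mul_cycle, ← Matrix.mul_assoc, (hsupp _).2, hAA']

/-- **Lower bound of the proof of GdLL Theorem 1.1** (p16: "Let `M` be a completely positive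
semidefinite matrix constructed from `p` as indicated in Theorem 5.1, so that `cpsd-rank_ℂ(M) = d`"),
the inequality `cpsd-rank_ℂ(M) ≥ 2^{⌊rank C/2⌋}` isolated: if the off-diagonal block of `G` is an
extreme point `C` of `Cor(n,m)`, every `CS_+`-factorization of the table `¼(1 + (−1)^a(−1)^{a'}G_{zz'})`
has size `≥ 2^{⌊rank(C)/2⌋}` (`exists_tensorRep_of_cpsdFactorization_quarterTable`, then Corollary 4.5
`GriblingDelaatLaurent2017_cor45`).
[cite: GriblingDelaatLaurent2017, proof of Thm. 1.1 (p16), Cor. 4.5 (p15), Thm. 5.1, Lemma 5.2 (p16)] -/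
theorem GriblingDelaatLaurent2017_quarterTable_lower {d : ℕ} (hn : 0 < n)
    (G : Matrix (Fin n ⊕ Fin m) (Fin n ⊕ Fin m) ℝ) {C : Matrix (Fin n) (Fin m) ℝ}
    (hCG : ∀ x y, C x y = G (Sum.inl x) (Sum.inr y))
    (hC : C ∈ Set.extremePoints ℝ (quantumCorrelations n m))
    (P : Bool × (Fin n ⊕ Fin m) → Matrix (Fin d) (Fin d) ℂ) (hPpsd : ∀ i, (P i).PosSemidef)
    (hPgram : ∀ a z a' z', (P (a, z) * P (a', z')).trace =
      ((((1 + (bif a then -1 else 1) * (bif a' then -1 else 1) * G z z') / 4 : ℝ)) : ℂ)) :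
    2 ^ (C.rank / 2) ≤ d := by
  obtain ⟨r, hr, M, N, ρ, hM, hN, hρ, hρ1, hc⟩ :=
    exists_tensorRep_of_cpsdFactorization_quarterTable hn G P hPpsd hPgram
  have h := GriblingDelaatLaurent2017_cor45 hC M N ρ hM hN hρ hρ1 (fun x y => by rw [hCG]; exact hc x y)
  exact h.trans hr

end GdLL5

/-! ### PSVW Theorem 16 / Result 1 with the squared exponent (GdLL Corollary 4.5 in place of
Theorem 11; appended)

GdLL §1 (p03) present Theorem 1.1 as an improvement of PSVW's `2^{Ω(√n)}` family; the mechanism is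
that Corollary 4.5 (`2^{⌊r/2⌋}`) replaces PSVW Theorem 11 (`√2^{⌊r/2⌋}`) in PSVW's Proof of Theorem 16.
For the record, the tree's PSVW statements sharpen accordingly: PSVW's behavior matrix
`P_C = ¼[J+C, J−C; J−C, J+C]` of `C ∈ ext(𝓔_n)` is the principal submatrix on `{0,1} × S` of the
table `¼(1 ± G)` for the extension `G = [C, C; C, C]` (GdLL Lemma 3.4), a `CS_+`-factorization of
`P_C` serves both sides of that table, and `GriblingDelaatLaurent2017_quarterTable_lower` applies with
`C ∈ ext Cor(n,n)` (PSVW Proposition 2).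
-/

section Thm16Sharp

/-- **PSVW Theorem 16 with GdLL's exponent**: for `n ≥ 1` and `C ∈ ext(𝓔_n)`, every
`CS_+`-factorization of the behavior matrix `P_C` has size `≥ 2^{⌊rank(C)/2⌋}` (PSVW Theorem 16 gives
`√2^{⌊rank(C)/2⌋}` at `rank C = r_max(n)`; the square comes from GdLL Corollary 4.5). Proof: the
factors `P_{(a,x)}` of `P_C` (`a = 0`: row `inl x`, `a = 1`: row `inr x`), used on both sides, form a
`CS_+`-factorization of the table `¼(1 + (−1)^a(−1)^{a'}C_{xx'})` over `{0,1} × ([n] ⊔ [n])`, and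
`GriblingDelaatLaurent2017_quarterTable_lower` applies (`C ∈ ext Cor(n,n)` by PSVW Proposition 2).
[cite: GriblingDelaatLaurent2017, Cor. 4.5 (p15), Thm. 5.1 (p16), §1 (p03); PrakashEtAl2017, Thm. 16 (p19–p20)] -/
theorem two_pow_le_of_hasCpsdFactorization_behaviorMatrix {n d : ℕ} (hn : 1 ≤ n)
    {C : Matrix (Fin n) (Fin n) ℝ} (hC : C ∈ Set.extremePoints ℝ (elliptope n))
    (h : HasCpsdFactorization (behaviorMatrix C) d) : 2 ^ (C.rank / 2) ≤ d := by
  classical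
  obtain ⟨P, hPpsd, hPgram⟩ := h
  let idx : Fin n ⊕ Fin n → Fin n := Sum.elim id id
  let G : Matrix (Fin n ⊕ Fin n) (Fin n ⊕ Fin n) ℝ := Matrix.of fun z z' => C (idx z) (idx z')
  let side : Bool × (Fin n ⊕ Fin n) → Fin n ⊕ Fin n := fun i =>
    bif i.1 then Sum.inr (idx i.2) else Sum.inl (idx i.2)
  -- entries of the behavior matrix
  have hB11 : ∀ x y, behaviorMatrix C (Sum.inl x) (Sum.inl y) = (1 + C x y) / 4 := fun x y => by
    simp only [behaviorMatrix, Matrix.smul_apply, Matrix.fromBlocks_apply₁₁, Matrix.add_apply,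
      Matrix.of_apply, smul_eq_mul]; ring
  have hB12 : ∀ x y, behaviorMatrix C (Sum.inl x) (Sum.inr y) = (1 - C x y) / 4 := fun x y => by
    simp only [behaviorMatrix, Matrix.smul_apply, Matrix.fromBlocks_apply₁₂, Matrix.sub_apply,
      Matrix.of_apply, smul_eq_mul]; ring
  have hB21 : ∀ x y, behaviorMatrix C (Sum.inr x) (Sum.inl y) = (1 - C x y) / 4 := fun x y => by
    simp only [behaviorMatrix, Matrix.smul_apply, Matrix.fromBlocks_apply₂₁, Matrix.sub_apply,
      Matrix.of_apply, smul_eq_mul]; ring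
  have hB22 : ∀ x y, behaviorMatrix C (Sum.inr x) (Sum.inr y) = (1 + C x y) / 4 := fun x y => by
    simp only [behaviorMatrix, Matrix.smul_apply, Matrix.fromBlocks_apply₂₂, Matrix.add_apply,
      Matrix.of_apply, smul_eq_mul]; ring
  refine GriblingDelaatLaurent2017_quarterTable_lower (n := n) (m := n) hn G (C := C)
    (fun x y => rfl) (mem_extremePoints_quantumCorrelations_of_elliptope hC)
    (fun i => P (side i)) (fun i => hPpsd _) fun a z a' z' => ?_
  rw [← hPgram]
  simp only [side, G, Matrix.of_apply]
  cases a <;> cases a' <;>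
    simp only [cond_true, cond_false, hB11, hB12, hB21, hB22] <;> push_cast <;> ring

/-- **PSVW Result 1 with GdLL's exponent**: for every `n ≥ 1` there is a `2n × 2n` Gram–Lorentz
matrix `X_n` (the behavior matrix of a maximal-rank extreme point of the elliptope, PSVW Theorem 14)
all of whose `CS_+`-factorizations have size `≥ 2^{⌊r_max(n)/2⌋}` (PSVW: `√2^{⌊r_max(n)/2⌋}`).
[cite: GriblingDelaatLaurent2017, §1 (p03), Cor. 4.5 (p15); PrakashEtAl2017, Result 1 (p06), Thm. 14 (p18), Thm. 16 (p19)] -/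
theorem PrakashEtAl2017_result1_sharp (n : ℕ) (hn : 1 ≤ n) :
    ∃ X : Matrix (Fin n ⊕ Fin n) (Fin n ⊕ Fin n) ℝ, IsGramLorentz X ∧
      ∀ d : ℕ, HasCpsdFactorization X d → 2 ^ (elliptopeMaxRank n / 2) ≤ d := by
  have hr : 1 ≤ elliptopeMaxRank n := by
    unfold elliptopeMaxRank
    have h9 : 3 ≤ Nat.sqrt (1 + 8 * n) := by
      rw [Nat.le_sqrt]
      omega
    omega
  obtain ⟨C, hC, hrank⟩ := (PrakashEtAl2017_thm14_holds n).2 (elliptopeMaxRank n) hr le_rfl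
  refine ⟨behaviorMatrix C, isGramLorentz_behaviorMatrix hC.1, fun d hd => ?_⟩
  rw [← hrank]
  exact two_pow_le_of_hasCpsdFactorization_behaviorMatrix hn hC hd

end Thm16Sharp

/-! ### GdLL Theorem 4.1 (1)⇒(2) / Corollary 4.2: existence of tensor operator representations in
local dimension `2^{⌊r/2⌋}` (appended)

GdLL Theorem 4.1 (p13), proof of (1)⇒(2): for a `C`-system `{x_s}, {y_t} ⊂ ℝ^r` set `d = 2^{⌊r/2⌋}`,
`X_s = Σ_i x_s(i)π(a_i)`, `Y_t = Σ_i y_t(i)π(a_i)ᵀ`, `ψ = d^{-1/2}Σ_i e_i ⊗ e_i`; then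
`C_{s,t} = ⟨x_s,y_t⟩ = Tr(X_sY_tᵀ)/d = ψ*(X_s ⊗ Y_t)ψ`. Corollary 4.2 (p13): "If `C` is a bipartite
correlation matrix of rank `r`, then it admits a tensor operator representation in local dimension
`2^{⌊r/2⌋}`." Formalized through the tree's Clifford/Brauer–Weyl isometry `exists_lorentz_isometry`
(PSVW Theorems 5–6) and the compression `exists_tensorRep_of_cpsdFactorization_quarterTable` above:
the factors `Γ((½, ±z/2))` of the table `¼(1 ± ⟨z,z'⟩)` for the vectors of the `C`-system have size
`2^{⌊N/2⌋}`, so the off-diagonal block `C` gets a tensor operator representation in local dimension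
`≤ 2^{⌊N/2⌋}` (the compressed dimension `rank K` can only be smaller, which is harmless for an
existence statement; for `N = 1` the scalars `x_s, y_t ∈ [−1,1]` themselves are the representation).
With `τ_C = rank C` (`finrank_span_eq_rank_of_mem_extremePoints`) this is the existence half of
Corollary 4.5, complementing `GriblingDelaatLaurent2017_cor45`.
-/

section GdLL42

variable {n m : ℕ}

/-- **GdLL Theorem 4.1 (1)⇒(2) / Corollary 4.2** (p13): a correlation matrix with a `C`-system in
`ℝ^N` (`|S| ≥ 1`) admits a tensor operator representation — observables `−I ⪯ M_s, N_t ⪯ I` and a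
state `ρ` on `ℂ^r ⊗ ℂ^r` with `C_{s,t} = Tr((M_s ⊗ N_t)ρ)` — in local dimension `r ≤ 2^{⌊N/2⌋}`. Proof
via the Clifford isometry `exists_lorentz_isometry` (factors `Γ((½, ±z/2))` of size `2^{⌊N/2⌋}`, psd as
`‖z‖ ≤ 1`) and `exists_tensorRep_of_cpsdFactorization_quarterTable`; `N = 1` by the scalar
representation `M_s = x_s`, `N_t = y_t`, `ρ = 1` on `ℂ^1`.
[cite: GriblingDelaatLaurent2017, Thm. 4.1 (1)⇒(2) and Cor. 4.2 (p13)] -/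
theorem exists_tensorRep_of_isCSystem {N : ℕ} (hn : 0 < n) {C : Matrix (Fin n) (Fin m) ℝ}
    {u : Fin n → EuclideanSpace ℝ (Fin N)} {v : Fin m → EuclideanSpace ℝ (Fin N)}
    (h : IsCSystem C u v) :
    ∃ r : ℕ, r ≤ 2 ^ (N / 2) ∧ ∃ (M : Fin n → Matrix (Fin r) (Fin r) ℂ)
      (Nm : Fin m → Matrix (Fin r) (Fin r) ℂ) (ρ : Matrix (Fin r × Fin r) (Fin r × Fin r) ℂ),
      (∀ x, (M x).IsHermitian ∧ (1 - M x).PosSemidef ∧ (1 + M x).PosSemidef) ∧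
      (∀ y, (Nm y).IsHermitian ∧ (1 - Nm y).PosSemidef ∧ (1 + Nm y).PosSemidef) ∧
      ρ.PosSemidef ∧ ρ.trace = 1 ∧ ∀ x y, ((C x y : ℝ) : ℂ) = ((M x ⊗ₖ Nm y) * ρ).trace := by
  classical
  obtain ⟨hu, hv, hC⟩ := h
  rcases eq_or_ne N 1 with hN1 | hN1
  · -- `N = 1`: scalars
    subst hN1
    have hu1 : ∀ x, |u x 0| ≤ 1 := fun x => by
      have h1 : ‖u x‖ ^ 2 = (u x 0) ^ 2 := by
        rw [EuclideanSpace.real_norm_sq_eq, Fin.sum_univ_one]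
      have h2 : ‖u x‖ ^ 2 ≤ 1 := by
        have := hu x; nlinarith [norm_nonneg (u x)]
      rw [h1] at h2
      exact (sq_le_one_iff_abs_le_one _).mp h2
    have hv1 : ∀ y, |v y 0| ≤ 1 := fun y => by
      have h1 : ‖v y‖ ^ 2 = (v y 0) ^ 2 := by
        rw [EuclideanSpace.real_norm_sq_eq, Fin.sum_univ_one]
      have h2 : ‖v y‖ ^ 2 ≤ 1 := by
        have := hv y; nlinarith [norm_nonneg (v y)]
      rw [h1] at h2
      exact (sq_le_one_iff_abs_le_one _).mp h2
    have hinner : ∀ x y, C x y = u x 0 * v y 0 := fun x y => by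
      rw [hC, EuclideanSpace.inner_eq_star_dotProduct, star_trivial, dotProduct, Fin.sum_univ_one,
        mul_comm]
    have hsc : ∀ a : ℝ, |a| ≤ 1 →
        (((a : ℝ) : ℂ) • (1 : Matrix (Fin 1) (Fin 1) ℂ)).IsHermitian ∧
        (1 - ((a : ℝ) : ℂ) • (1 : Matrix (Fin 1) (Fin 1) ℂ)).PosSemidef ∧
        (1 + ((a : ℝ) : ℂ) • (1 : Matrix (Fin 1) (Fin 1) ℂ)).PosSemidef := by
      intro a ha
      have ha' := abs_le.mp ha
      refine ⟨?_, ?_, ?_⟩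
      · unfold Matrix.IsHermitian
        rw [conjTranspose_smul, conjTranspose_one, Complex.star_def, Complex.conj_ofReal]
      · have : (1 : Matrix (Fin 1) (Fin 1) ℂ) - ((a : ℝ) : ℂ) • 1 = (((1 - a : ℝ)) : ℂ) • 1 := by
          rw [Complex.ofReal_sub, Complex.ofReal_one, sub_smul, one_smul]
        rw [this]
        exact PosSemidef.one.smul (Complex.zero_le_real.mpr (by linarith))
      · have : (1 : Matrix (Fin 1) (Fin 1) ℂ) + ((a : ℝ) : ℂ) • 1 = (((1 + a : ℝ)) : ℂ) • 1 := by
          rw [Complex.ofReal_add, Complex.ofReal_one, add_smul, one_smul]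
        rw [this]
        exact PosSemidef.one.smul (Complex.zero_le_real.mpr (by linarith))
    refine ⟨1, by norm_num, fun x => ((u x 0 : ℝ) : ℂ) • 1, fun y => ((v y 0 : ℝ) : ℂ) • 1, 1,
      fun x => hsc _ (hu1 x), fun y => hsc _ (hv1 y), PosSemidef.one, by simp, fun x y => ?_⟩
    rw [hinner, Matrix.mul_one, Matrix.smul_kronecker, Matrix.kronecker_smul, one_kronecker_one,
      smul_smul, trace_smul, trace_one, Fintype.card_prod, Fintype.card_fin]
    push_cast
    ring
  · -- `N ≠ 1`: the Clifford factors of the quarter table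
    obtain ⟨Γ, -, htr, hpsd⟩ := exists_lorentz_isometry (k := N) hN1
    let w : Fin n ⊕ Fin m → EuclideanSpace ℝ (Fin N) := Sum.elim u v
    have hw : ∀ z, ‖w z‖ ≤ 1 := fun z => by
      rcases z with x | y
      · exact hu x
      · exact hv y
    let G : Matrix (Fin n ⊕ Fin m) (Fin n ⊕ Fin m) ℝ := Matrix.of fun z z' => inner ℝ (w z) (w z')
    let pt : Bool × (Fin n ⊕ Fin m) → ℝ × (Fin N → ℝ) := fun i =>
      (1 / 2, fun l => (bif i.1 then -1 else 1) / 2 * w i.2 l)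
    have hsign : ∀ a : Bool, (bif a then (-1 : ℝ) else 1) * (bif a then -1 else 1) = 1 := fun a => by
      cases a <;> simp
    have hinner : ∀ z z' : Fin n ⊕ Fin m, inner ℝ (w z) (w z') = ∑ l, w z l * w z' l := fun z z' => by
      rw [EuclideanSpace.inner_eq_star_dotProduct, star_trivial, dotProduct]
      exact Finset.sum_congr rfl fun l _ => mul_comm _ _
    have hnormsq : ∀ z, ∑ l, w z l * w z l = ‖w z‖ ^ 2 := fun z => by
      rw [← hinner, real_inner_self_eq_norm_sq]
    obtain ⟨r, hr, M, Nm, ρ, hM, hN, hρ, hρ1, hc⟩ :=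
      exists_tensorRep_of_cpsdFactorization_quarterTable (n := n) (m := m) hn G (fun i => Γ (pt i))
        (fun i => by
          rw [hpsd]
          have hs : ∑ l, ((pt i).2 l) ^ 2 = ‖w i.2‖ ^ 2 / 4 := by
            simp only [pt]
            calc ∑ l, ((bif i.1 then -1 else 1) / 2 * w i.2 l) ^ 2
                = ((bif i.1 then -1 else 1) * (bif i.1 then -1 else 1)) / 4 *
                    ∑ l, w i.2 l * w i.2 l := by
                  rw [Finset.mul_sum]; exact Finset.sum_congr rfl fun l _ => by ring
              _ = ‖w i.2‖ ^ 2 / 4 := by rw [hsign, hnormsq]; ring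
          rw [hs, show ‖w i.2‖ ^ 2 / 4 = (‖w i.2‖ / 2) ^ 2 by ring,
            Real.sqrt_sq (by positivity)]
          show ‖w i.2‖ / 2 ≤ 1 / 2
          linarith [hw i.2])
        (fun a z a' z' => by
          rw [htr]
          congr 1
          simp only [pt, G, Matrix.of_apply, hinner]
          have hsum : ∑ l, (bif a then -1 else 1) / 2 * w z l * ((bif a' then -1 else 1) / 2 * w z' l) =
              (bif a then -1 else 1) * (bif a' then -1 else 1) / 4 * ∑ l, w z l * w z' l := by
            rw [Finset.mul_sum]; exact Finset.sum_congr rfl fun l _ => by ring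
          rw [hsum]
          ring)
    refine ⟨r, hr, M, Nm, ρ, hM, hN, hρ, hρ1, fun x y => ?_⟩
    rw [← hc x y, hC x y]
    rfl

/-- **GdLL Corollary 4.5, existence half** (p15: "The minimum local dimension of a tensor operator
representation of `C` is `2^{⌊r/2⌋}`" for `C` extreme of rank `r`): an extreme `C ∈ Cor(n,m)`
(`n, m ≥ 1`) HAS a tensor operator representation in local dimension exactly `2^{⌊rank C/2⌋}`: Lemma 12
moves a `C`-system into `ℝ^{τ_C}` with `τ_C = rank C` (`finrank_span_eq_rank_of_mem_extremePoints`),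
Corollary 4.2 (`exists_tensorRep_of_isCSystem`) gives local dimension `r ≤ 2^{⌊rank C/2⌋}`, and the
lower bound `GriblingDelaatLaurent2017_cor45` forces `r = 2^{⌊rank C/2⌋}`.
[cite: GriblingDelaatLaurent2017, Cor. 4.5 (p15), Cor. 4.2 (p13)] -/
theorem GriblingDelaatLaurent2017_cor45_exists {C : Matrix (Fin n) (Fin m) ℝ} (hn : 0 < n) (hm : 0 < m)
    (hC : C ∈ Set.extremePoints ℝ (quantumCorrelations n m)) :
    ∃ (M : Fin n → Matrix (Fin (2 ^ (C.rank / 2))) (Fin (2 ^ (C.rank / 2))) ℂ)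
      (Nm : Fin m → Matrix (Fin (2 ^ (C.rank / 2))) (Fin (2 ^ (C.rank / 2))) ℂ)
      (ρ : Matrix (Fin (2 ^ (C.rank / 2)) × Fin (2 ^ (C.rank / 2)))
        (Fin (2 ^ (C.rank / 2)) × Fin (2 ^ (C.rank / 2))) ℂ),
      (∀ x, (M x).IsHermitian ∧ (1 - M x).PosSemidef ∧ (1 + M x).PosSemidef) ∧
      (∀ y, (Nm y).IsHermitian ∧ (1 - Nm y).PosSemidef ∧ (1 + Nm y).PosSemidef) ∧
      ρ.PosSemidef ∧ ρ.trace = 1 ∧ ∀ x y, ((C x y : ℝ) : ℂ) = ((M x ⊗ₖ Nm y) * ρ).trace := by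
  classical
  obtain ⟨hspan, -⟩ := Tsirelson1987_lemma12_holds n m C hn hm hC
  obtain ⟨u0, v0, hu0, hv0, hCuv⟩ := hC.1
  have hsys0 : IsCSystem C u0 v0 := ⟨fun x => (hu0 x).le, fun y => (hv0 y).le, hCuv⟩
  let W : Submodule ℝ (EuclideanSpace ℝ (Fin (n + m))) := Submodule.span ℝ (Set.range u0)
  have hW : Module.finrank ℝ W = C.rank := finrank_span_eq_rank_of_mem_extremePoints hn hm hC hsys0
  let φ : W ≃ₗᵢ[ℝ] EuclideanSpace ℝ (Fin C.rank) :=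
    ((stdOrthonormalBasis ℝ W).reindex (finCongr hW)).repr
  have huW : ∀ x, u0 x ∈ W := fun x => Submodule.subset_span ⟨x, rfl⟩
  have hvW : ∀ y, v0 y ∈ W := fun y => by
    show v0 y ∈ Submodule.span ℝ (Set.range u0)
    rw [hspan _ u0 v0 hsys0]
    exact Submodule.subset_span ⟨y, rfl⟩
  let u : Fin n → EuclideanSpace ℝ (Fin C.rank) := fun x => φ ⟨u0 x, huW x⟩
  let v : Fin m → EuclideanSpace ℝ (Fin C.rank) := fun y => φ ⟨v0 y, hvW y⟩
  have hsys : IsCSystem C u v := by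
    refine ⟨fun x => ?_, fun y => ?_, fun x y => ?_⟩
    · simp only [u, LinearIsometryEquiv.norm_map]
      exact (hu0 x).le
    · simp only [v, LinearIsometryEquiv.norm_map]
      exact (hv0 y).le
    · simp only [u, v, LinearIsometryEquiv.inner_map_map, Submodule.coe_inner]
      exact hCuv x y
  obtain ⟨r, hr, M, Nm, ρ, hM, hN, hρ, hρ1, hc⟩ := exists_tensorRep_of_isCSystem hn hsys
  have hge := GriblingDelaatLaurent2017_cor45 hC M Nm ρ hM hN hρ hρ1 hc
  have hreq : r = 2 ^ (C.rank / 2) := le_antisymm hr hge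
  subst hreq
  exact ⟨M, Nm, ρ, hM, hN, hρ, hρ1, hc⟩

/-- **GdLL Corollary 4.5** (p15, verbatim): "Let `C` be an extreme point of `Cor(m,n)` and let
`r = rank(C)`. The minimum local dimension of a tensor operator representation of `C` is `2^{⌊r/2⌋}`."
Typed as an `IsLeast` statement over the set of local dimensions `d` admitting a tensor operator
representation of `C` in the format of `PrakashEtAl2017_thm11` (observables `M_x ⊗ N_y`, `−I ⪯ M_x,
N_y ⪯ I`, a state `ρ` on `ℂ^d ⊗ ℂ^d` — mixed states allowed, as in PSVW; `n, m ≥ 1`).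
[cite: GriblingDelaatLaurent2017, Cor. 4.5 (p15)] -/
theorem GriblingDelaatLaurent2017_cor45_isLeast {C : Matrix (Fin n) (Fin m) ℝ} (hn : 0 < n) (hm : 0 < m)
    (hC : C ∈ Set.extremePoints ℝ (quantumCorrelations n m)) :
    IsLeast {d : ℕ | ∃ (M : Fin n → Matrix (Fin d) (Fin d) ℂ) (Nm : Fin m → Matrix (Fin d) (Fin d) ℂ)
      (ρ : Matrix (Fin d × Fin d) (Fin d × Fin d) ℂ),
      (∀ x, (M x).IsHermitian ∧ (1 - M x).PosSemidef ∧ (1 + M x).PosSemidef) ∧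
      (∀ y, (Nm y).IsHermitian ∧ (1 - Nm y).PosSemidef ∧ (1 + Nm y).PosSemidef) ∧
      ρ.PosSemidef ∧ ρ.trace = 1 ∧ ∀ x y, ((C x y : ℝ) : ℂ) = ((M x ⊗ₖ Nm y) * ρ).trace}
      (2 ^ (C.rank / 2)) :=
  ⟨GriblingDelaatLaurent2017_cor45_exists hn hm hC,
    fun _ ⟨M, Nm, ρ, hM, hN, hρ, hρ1, hc⟩ => GriblingDelaatLaurent2017_cor45 hC M Nm ρ hM hN hρ hρ1 hc⟩

end GdLL42

/-! ### PSVW Theorem 10 (i) ⇔ (iii): Tsirelson's theorem on quantum correlations (appended)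

PSVW Theorem 10 ([TS87], p17, verbatim): "For any `C = (c_{xy}) ∈ [−1,1]^{n×m}` the following are
equivalent: (i) `C` is a quantum correlation, i.e., there exist Hermitian operators `{M_x}_x, {N_y}_y`
with eigenvalues in `[−1,1]` and a quantum state `ρ` satisfying `c_{xy} = tr((M_x ⊗ N_y)ρ)` for all
`x ∈ [n], y ∈ [m]`. (ii) [the explicit Clifford form with `γ(u_x) ⊗ γ(v_y)ᵀ` and the maximally
entangled state] (iii) There exist unit vectors `{u_x}_x` and `{v_y}_y` in `ℝ^{n+m}` such that
`c_{xy} = ⟨u_x, v_y⟩` for all `x, y`." (= GdLL Theorem 4.1 (1)⇔(2)⇔(4).) Here (i)⇔(iii) is assembled: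
(i)⇒(iii) by `isRep_kronecker` and `mem_quantumCorrelations_of_commutingRep`
(`TsirelsonExtremalCorrelations.lean`), (iii)⇒(i) by `exists_tensorRep_of_isCSystem` (the Clifford
construction of (ii), up to PSVW's normalisation (b)–(c), which is not formalized).
-/

section Thm10

variable {n m : ℕ}

/-- **PSVW Theorem 10 (i)⇒(iii)**: a tensor operator representation (`M_x ⊗ N_y`, state `ρ` on
`ℂ^d ⊗ ℂ^d`) of `C` forces `C ∈ Cor(n,m)` (through the commuting representation `M_x ⊗ I`,
`I ⊗ N_y`). [cite: PrakashEtAl2017, Thm. 10 (p17); GriblingDelaatLaurent2017, Thm. 4.1 (p13)] -/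
theorem mem_quantumCorrelations_of_tensorRep {d : ℕ} {C : Matrix (Fin n) (Fin m) ℝ}
    (M : Fin n → Matrix (Fin d) (Fin d) ℂ) (N : Fin m → Matrix (Fin d) (Fin d) ℂ)
    (ρ : Matrix (Fin d × Fin d) (Fin d × Fin d) ℂ)
    (hM : ∀ x, (M x).IsHermitian ∧ (1 - M x).PosSemidef ∧ (1 + M x).PosSemidef)
    (hN : ∀ y, (N y).IsHermitian ∧ (1 - N y).PosSemidef ∧ (1 + N y).PosSemidef)
    (hρ : ρ.PosSemidef) (hρ1 : ρ.trace = 1)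
    (hc : ∀ x y, ((C x y : ℝ) : ℂ) = ((M x ⊗ₖ N y) * ρ).trace) :
    C ∈ quantumCorrelations n m := by
  classical
  obtain ⟨h1, -, h3, h4, h5, h6⟩ := isRep_kronecker C M N ρ hM hN hρ hρ1 hc
  exact mem_quantumCorrelations_of_commutingRep _ _ ρ h1 h3 h4 h5 h6

/-- **PSVW Theorem 10, (i) ⇔ (iii) [Tsirelson 1987]** (p17): `C` has a tensor operator representation
(Hermitian `M_x, N_y` with spectra in `[−1,1]` on some `ℂ^d`, a state `ρ` on `ℂ^d ⊗ ℂ^d`,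
`c_{xy} = Tr((M_x ⊗ N_y)ρ)`) iff `C ∈ Cor(n,m)` (unit vectors `u_x, v_y ∈ ℝ^{n+m}` with
`c_{xy} = ⟨u_x, v_y⟩`). Typed for `n ≥ 1` (Bell scenario); the dimension in (i) is existentially
quantified (by `exists_tensorRep_of_isCSystem` one may take `d ≤ 2^{⌊(n+m)/2⌋}`, PSVW's
`d = 2^{⌊(n+m)/2⌋}` of (ii)). [cite: PrakashEtAl2017, Thm. 10 (i)⇔(iii) (p17), after Tsirelson1987] -/
theorem PrakashEtAl2017_thm10_i_iff_iii (hn : 0 < n) (C : Matrix (Fin n) (Fin m) ℝ) :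
    (∃ (d : ℕ) (M : Fin n → Matrix (Fin d) (Fin d) ℂ) (N : Fin m → Matrix (Fin d) (Fin d) ℂ)
        (ρ : Matrix (Fin d × Fin d) (Fin d × Fin d) ℂ),
        (∀ x, (M x).IsHermitian ∧ (1 - M x).PosSemidef ∧ (1 + M x).PosSemidef) ∧
        (∀ y, (N y).IsHermitian ∧ (1 - N y).PosSemidef ∧ (1 + N y).PosSemidef) ∧
        ρ.PosSemidef ∧ ρ.trace = 1 ∧ ∀ x y, ((C x y : ℝ) : ℂ) = ((M x ⊗ₖ N y) * ρ).trace) ↔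
      C ∈ quantumCorrelations n m := by
  constructor
  · rintro ⟨d, M, N, ρ, hM, hN, hρ, hρ1, hc⟩
    exact mem_quantumCorrelations_of_tensorRep M N ρ hM hN hρ hρ1 hc
  · rintro ⟨u, v, hu, hv, hC⟩
    have hsys : IsCSystem C u v := ⟨fun x => (hu x).le, fun y => (hv y).le, hC⟩
    obtain ⟨r, -, M, N, ρ, hM, hN, hρ, hρ1, hc⟩ := exists_tensorRep_of_isCSystem hn hsys
    exact ⟨r, M, N, ρ, hM, hN, hρ, hρ1, hc⟩

/-- With the dimension bound of (ii): `C ∈ Cor(n,m)` (`n ≥ 1`) has a tensor operator representation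
in local dimension `≤ 2^{⌊(n+m)/2⌋}`. [cite: PrakashEtAl2017, Thm. 10 (ii) (p17)] -/
theorem exists_tensorRep_of_mem_quantumCorrelations (hn : 0 < n) {C : Matrix (Fin n) (Fin m) ℝ}
    (hC : C ∈ quantumCorrelations n m) :
    ∃ r : ℕ, r ≤ 2 ^ ((n + m) / 2) ∧ ∃ (M : Fin n → Matrix (Fin r) (Fin r) ℂ)
      (N : Fin m → Matrix (Fin r) (Fin r) ℂ) (ρ : Matrix (Fin r × Fin r) (Fin r × Fin r) ℂ),
      (∀ x, (M x).IsHermitian ∧ (1 - M x).PosSemidef ∧ (1 + M x).PosSemidef) ∧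
      (∀ y, (N y).IsHermitian ∧ (1 - N y).PosSemidef ∧ (1 + N y).PosSemidef) ∧
      ρ.PosSemidef ∧ ρ.trace = 1 ∧ ∀ x y, ((C x y : ℝ) : ℂ) = ((M x ⊗ₖ N y) * ρ).trace := by
  obtain ⟨u, v, hu, hv, hC⟩ := hC
  exact exists_tensorRep_of_isCSystem hn ⟨fun x => (hu x).le, fun y => (hv y).le, hC⟩

end Thm10

end Literature.Combinatorics.Optimization
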